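import Literature.LinearAlgebra.Matrix.GL3ZIntegerEigenvaluesTriangular
import Literature.LinearAlgebra.Matrix.NonSemisimpleIntegerMatrixClassesInfinite
import Mathlib.Data.Nat.Totient
import HarnessLib

/-!
# Integer `3 × 3` matrices with JORDAN BLOCKS OF SIZES `2` AND `1` (a `2 × 2` Jordan block with eigenvalue `λ`, a
# `1 × 1` block with eigenvalue `μ ≠ λ`): UNIQUE NORMAL FORMS under `GL₃(ℤ)`-conjugation
# (Hertling–Larabi 2026b §11, Lemma 11.1 (c) and (f), with Theorem 6.3)

[topic LinearAlgebra/Matrix] Sequel to `GL3ZIntegerEigenvaluesTriangular` (p19 g40-#2: every integer `3 × 3` matrix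
with three integer eigenvalues is `GL₃(ℤ)`-conjugate to an upper triangular one with the eigenvalues in ANY prescribed
order, `GL3ZIntegerEigenvalues.exists_conj_upperTriangular`; the moves `triangular_shear₁₂_conj`,
`triangular_shear₂₃_conj`, `triangular_diag_conj`; `charpoly_triangular` — all REUSED by name) and of
`LatimerMacDuffeeOrderStrata` (`equivalence_conj`).  Hertling–Larabi's §11 treats the last rank-`3` Jordan type,
`(2, 1)`: by Theorem 6.3 the `GL₃(ℤ)`-conjugacy classes of integer `3 × 3` matrices with a `2 × 2` Jordan block
(eigenvalue `0`) and a `1 × 1` Jordan block (eigenvalue `α ∈ ℕ`) are the `ε`-classes of full lattices `L` of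
`A = ℚe₁ ⊕ ℚe₂ ⊕ ℚa` (`a² = 0`) with `𝒪(L) ⊇ Λ_α = ℤ[αe₁ + a]`; Lemma 11.1 (c) gives a unique lattice in each
`ε`-class and Lemma 11.1 (f) reads off the matrices (11.9) — «a normal form for each `GL₃(ℤ)`-conjugacy class».
This file proves the matrix statements DIRECTLY, including the uniqueness («We leave it to the reader to show that
no further reductions are possible»), with the normal forms parametrised by their three integer entries.  Lane
`lit-hodgefound` (Track 2 foundations library), seat p19 generation 41, rows g41-#1 (§§0–8) and g41-#2 (§§9–10: the
order of a class read off the normal form, and the class number `φ(α)/2` of the cyclic order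
`Λ_α = ℤ[t]/(t²(t − α))`, Theorem 11.2 (b)).  THEOREMS ONLY: no definition, no instance, no notation, no named fact
(D-0026, net Literature debt `0`), no `sorry`.

## Source, VERBATIM

C. Hertling, K. Larabi, *Conjugacy classes of regular integer matrices*, arXiv:2602.15748 (2026)
[HertlingLarabi2026b], held `paper:arxiv-2602.15748`, §11 «The rank 3 cases with Jordan blocks of sizes 2 and 1»
(chunks p0037–p0038): «A regular integer `3×3` matrix with a `2×2` Jordan block has two different integer
eigenvalues. By subtracting a suitable multiple of the unit matrix we can restrict to the case with eigenvalue
`α ∈ ℤ − {0}` for the `1×1` Jordan block and the eigenvalue `0` for the `2×2` Jordan block. By multiplying the matrix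
with the sign of `α` we can restrict to the case `α ∈ ℕ`. […] The conjugacy classes of integer `3×3` matrices with a
`2×2` Jordan block with eigenvalue `0` and a `1×1` Jordan block with eigenvalue `α ∈ ℕ` correspond by Theorem 6.3
1:1 to the `ε`-classes of `Λ_α`-ideals `{[L]_ε | L ∈ 𝓛(A), 𝒪(L) ⊃ Λ_α}` […] Lemma 11.1 provides a `ℤ`-basis in
normal form for each order `Λ` in `A`, a unique representative in each `ε`-class of full lattices and a normal form
for each `GL_3(ℤ)`-conjugacy class […] **Lemma 11.1.** […] (c) Each `ε`-class of full lattices contains a unique full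
lattice `L` with a `ℤ`-basis of the following shape, `e·(0 1 δ₁; 0 0 1; δ₂ δ₃ 0)` with `δ₁ ∈ [0, ½] ∩ ℚ`,
`δ₂ ∈ ℚ_{>0}`, `δ₃ ∈ (−½δ₂, ½δ₂] ∩ ℚ` if `δ₁ ∈ (0, ½)`, `δ₃ ∈ [0, ½δ₂] ∩ ℚ` if `δ₁ ∈ {0, ½}` (11.6). […]
(f) (i) Let `L` be a full lattice with `ℤ`-basis `𝓑` in (11.6). The matrix `M_𝓑 ∈ M_{3×3}(ℚ)` with
`(αe₁ + a)𝓑 = 𝓑·M_𝓑` is `M_𝓑 = (0 −αδ₃/δ₂ 1/δ₂−αδ₁δ₃/δ₂; 0 α αδ₁; 0 0 0)` (11.9). It is in `M_{3×3}(ℤ)` if and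
only if `𝒪(L) ⊃ Λ_α`. (ii) The matrices `M_𝓑` in (11.9) for `(δ₁, δ₂, δ₃)` in (11.6) with `M_𝓑 ∈ M_{3×3}(ℤ)` are
representatives of the conjugacy classes of integer `3×3` matrices with eigenvalue `α` on the `1×1` Jordan block
and eigenvalue `0` on the `2×2` Jordan block. (We do not list the triples `(δ₁, δ₂, δ₃)` in (11.6) with
`M_𝓑 ∈ M_{3×3}(ℤ)` in a more explicit way.) **Proof:** […] (c) […] If `δ₁ = 0` the full lattice `(−e₁+e₂)L₃` has
the `ℤ`-basis `e(0 1 0; 0 0 1; δ₂ −δ₃ 0)`. If `δ₁ = ½` […] Therefore in the boundary cases `δ₁ ∈ {0, ½}` we can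
choose `δ₃ ∈ [0, ½δ₂] ∩ ℚ`. We leave it to the reader to show that no further reductions are possible. […]
(f) (i) is a straightforward calculation. (ii) is clear. □»  Lemma 11.1 (b): «An order `Λ` with `ℤ`-basis as in
(11.3) contains `Λ_α` if and only if there exist `n₁ ∈ {ñ₁ ∈ ℕ | ñ₁ | α}`, `n₃ ∈ [0, α/n₁) ∩ ℤ`,
`n₂ ∈ (n₁²n₃ + ℤα) ∩ ℕ` with `α₁ = α/n₁`, `α₂ = α/n₂`, `α₃ = n₁n₃/n₂` (11.4). Then `Λ = Λ_α` if and only if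
`n₁ = n₂ = n₃ = 1`.»; (e): «Let `L` be a full lattice with `ℤ`-basis in (11.6). The `ℤ`-basis in (11.3) of the
order `𝒪(L)` satisfies `α₂ = δ₂`, `α₁ = lcm(δ_ℚ(δ₁), δ_ℚ(δ₃/δ₂))` […] (11.8).»  Theorem 11.2 (chunks p0038–p0039):
«(b) Consider an order `Λ` as in (11.3). […] Define `μ := gcd(α₁, α₃α₁/α₂) ∈ ℕ`, `t := |{p ∈ ℙ | p divides μ}|`,
`τ := 2^t`. (i) Then `τ` is the number of `w`-classes in the set `{[L]_ε | L ∈ 𝓛(A), 𝒪(L) = Λ}`. […] **Proof** […]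
(iii) The case `α₁ = 1`: […] there is only one `w`-class, the group `G([Λ]_ε)`. […] The case `α = 2`: It is similar to
the cases `α₁ ≥ 3`. Only `φ(α₁)/2` must be replaced by `1`. The cases `α ≥ 3`: […] Claims: (I) Each `w`-class within
the set `{[L]_ε | L ∈ 𝓛(A), 𝒪(L) = Λ}` contains `φ(α₁)/2` `ε`-classes. […] Proof of the claims: (I) By Theorem 9.1 (d)
`|G([pr_F Λ]_ε)| = φ(α₁)/2`. By Theorem 5.10 the homomorphism `pr_F : G([Λ]_ε) → G([pr_F Λ]_ε)` is an isomorphism,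
so `|G([Λ]_ε)| = φ(α₁)/2`.»  (For `Λ = Λ_α`: `(α₁, α₂, α₃) = (α, α, 1)` by (11.10), so `μ = 1`, `τ = 1`.)

## The matrix dictionary (entries of (11.9): `x = −αδ₃/δ₂`, `z = αδ₁`, `y = 1/δ₂ − αδ₁δ₃/δ₂`; `αy − xz = α/δ₂`)

Writing `T(x, y, z) := (0 x y; 0 α z; 0 0 0)` (`α ≥ 1`): `T² − αT = (xz − αy)·E₁₃`, so `T` has a `2 × 2` Jordan
block iff `d := αy − xz ≠ 0`; `|d|` is a class invariant (§2) and every `P ∈ GL₃(ℤ)` conjugating two such `T` is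
upper triangular (it preserves the flag `ker T ⊂ ker T(T − α)`).  The windows (11.6) for `(δ₁, δ₂, δ₃)` are, in
the entries, EXACTLY (§8 `normalForm_iff_delta`): `d > 0`, `0 ≤ 2z ≤ α`, `−α ≤ 2x < α`, and `x ≤ 0` in the
boundary cases `z ∈ {0, α/2}`.  Since `x, y, z` are then simply the integer entries, the set of normal forms is the
explicit set `{(x, y, z) ∈ ℤ³ | αy − xz > 0, 0 ≤ 2z ≤ α, −α ≤ 2x < α, (z = 0 ∨ 2z = α) → x ≤ 0}`.

## What is proved (`B ∼ B' :⟺ ∃ P, IsUnit (det P) ∧ PB = B'P`)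

* §1 the forms: `charpoly_form` (`χ_T = t²(t − α)`), `mul_self_sub_smul` (`T² − αT = (xz − αy)E₁₃`),
  `mul_self_eq_smul_iff` (`T² = αT ⟺ αy − xz = 0`); privately: the relation `N² = αN` is invariant under
  conjugation.
* §2 `upper_of_conj`: a conjugator between two forms with `d ≠ 0` is upper triangular, `diag_mul_self_eq_one_of_conj`
  (its diagonal entries are `±1`), and `sub_mul_eq_of_conj`: `d' = P₀₀P₂₂·d` — so `|αy − xz|` is an invariant
  (`natAbs_sub_mul_eq_of_conj`).
* §3 the moves specialised from `GL3ZIntegerEigenvaluesTriangular`: `shear₁₂_conj` (`x ↦ x + kα`, `y ↦ y + kz`),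
  `shear₂₃_conj` (`z ↦ z − kα`, `y ↦ y − kx`), `sign₃_conj` (`(x, y, z) ↦ (x, −y, −z)`), `sign₂_conj`
  (`(x, y, z) ↦ (−x, y, −z)`).
* §4 **existence** `exists_conj_normalForm_of_form`, `exists_conj_normalForm` (Lemma 11.1 (c)+(f)(ii)): every integer
  `N` with `χ_N = t²(t − α)`, `α ≥ 1`, `N² ≠ αN` is `GL₃(ℤ)`-conjugate to a normal form; §5 **uniqueness**
  `normalForm_unique` («no further reductions are possible»); §6 `existsUnique_conj_normalForm`, `normalForm_mem`, the
  BIJECTION `exists_bijective_quot_conj` between the classes and the explicit set of triples, and `infinite_quot_conj`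
  (infinitely many classes for every `α`, as Thm. 6.4 (c) says for a non-semisimple Jordan type: the forms
  `T(0, y, 0)`, `y ≥ 1`).
* §7 the general `(2, 1)` type: `existsUnique_conj_normalForm_of_charpoly` — `χ_N = (t − λ)²(t − μ)`, `λ ≠ μ`,
  `(N − λ)(N − μ) ≠ 0` ⟹ `N` is conjugate to exactly one `(λ sx sy; 0 μ sz; 0 0 λ)`, `s = sign(μ − λ)`,
  `(x, y, z)` a normal form for `α = |μ − λ|` («subtracting a suitable multiple of the unit matrix», «multiplying the
  matrix with the sign of `α`»).
* §8 `delta_mul_normalForm_eq` ((f)(i): `Δ·M_𝓑 = U·Δ` for the basis matrix `Δ` of (11.6) and the matrix `U` of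
  `αe₁ + a` in the basis `e`, «a straightforward calculation»), `sub_mul_eq_div_delta` (`αy − xz = α/δ₂`) and
  `normalForm_iff_delta` (the windows (11.6) ⟺ the entry windows above).
* §9 (row g41-#2) **the order of the class** (Lemma 11.1 (b), (e) on the matrix side): `smul_one_add_smul_add_smul_sq`,
  `isInt_smul_one_add_iff` (`u·1 + v·T + w·T² ∈ M_{3×3}(ℤ) ⟺ u, xW, αW, zW, vy + wxz ∈ ℤ`, `W = v + wα`),
  **`saturated_iff_sub_mul_eq_one`** / `saturated_iff_of_conj_normalForm` (`ℤ[N] = ℚ[N] ∩ M_{3×3}(ℤ)`, i.e. the order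
  of the class is the cyclic order `Λ_α`, iff `αy − xz = 1`), `gcd_entries_normalForm` /
  `gcd_entries_eq_of_conj_normalForm` (the content of `N² − αN` is the invariant `αy − xz = α/α₂`),
  **`saturated_iff_gcd_entries_eq_one`** (`ℤ[N]` saturated ⟺ `N² − αN` primitive).
* §10 (row g41-#2) **the class number of the cyclic order `Λ_α`** (Thm. 11.2 (b), Claim (I), with Thm. 9.1 (d)):
  `natCard_normalForm_sub_mul_eq_one` (the normal forms with `αy − xz = 1` number `φ(α)/2` for `α ≥ 3`: bijection
  with the residues `z ∈ (0, α/2)` prime to `α`), `exists_bijective_quot_conj_primitive`,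
  **`natCard_quot_conj_primitive`** (the `GL₃(ℤ)`-classes of `N` with `χ_N = t²(t − α)` and `N² − αN` primitive
  number `φ(α)/2` for `α ≥ 3`) and `natCard_quot_conj_primitive_of_le_two` (exactly one class for `α ∈ {1, 2}`).
NOT here: the lattice side of §11 (Lemma 11.1 (a)(d), Theorem 11.2 (a), (b)(ii)(iii), (c): orders in general,
invertibility, the `2^t` `w`-classes).
-/

open Matrix Polynomial

namespace Literature.LinearAlgebra.Matrix.GL3ZJordanBlocksTwoOne

open Literature.LinearAlgebra.Matrix.GL3ZIntegerEigenvalues (exists_conj_upperTriangular triangular_shear₁₂_conj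
  triangular_shear₂₃_conj triangular_diag_conj charpoly_triangular)
open Literature.LinearAlgebra.Matrix.LatimerMacDuffeeOrderStrata (equivalence_conj)

/-! ## §0 The conjugacy relation `B ∼ B' :⟺ ∃ P unimodular, PB = B'P` -/

/-- Transitivity of `GL₃(ℤ)`-conjugacy (HL26b Def./Lemma 6.1 (e)). [folklore] -/
private theorem conj_trans {B B' B'' : Matrix (Fin 3) (Fin 3) ℤ}
    (h : ∃ P : Matrix (Fin 3) (Fin 3) ℤ, IsUnit P.det ∧ P * B = B' * P)
    (h' : ∃ P : Matrix (Fin 3) (Fin 3) ℤ, IsUnit P.det ∧ P * B' = B'' * P) :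
    ∃ P : Matrix (Fin 3) (Fin 3) ℤ, IsUnit P.det ∧ P * B = B'' * P := by
  obtain ⟨P, hP, h⟩ := h
  obtain ⟨Q, hQ, h'⟩ := h'
  refine ⟨Q * P, by rw [Matrix.det_mul]; exact hQ.mul hP, ?_⟩
  rw [Matrix.mul_assoc, h, ← Matrix.mul_assoc, h', Matrix.mul_assoc]

/-- Symmetry of `GL₃(ℤ)`-conjugacy. [folklore] -/
private theorem conj_symm {B B' : Matrix (Fin 3) (Fin 3) ℤ}
    (h : ∃ P : Matrix (Fin 3) (Fin 3) ℤ, IsUnit P.det ∧ P * B = B' * P) :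
    ∃ P : Matrix (Fin 3) (Fin 3) ℤ, IsUnit P.det ∧ P * B' = B * P := by
  obtain ⟨P, hP, hPB⟩ := h
  refine ⟨P⁻¹, Matrix.isUnit_nonsing_inv_det P hP, ?_⟩
  calc P⁻¹ * B' = P⁻¹ * B' * (P * P⁻¹) := by rw [Matrix.mul_nonsing_inv P hP, Matrix.mul_one]
    _ = P⁻¹ * (B' * P) * P⁻¹ := by simp only [Matrix.mul_assoc]
    _ = P⁻¹ * (P * B) * P⁻¹ := by rw [hPB]
    _ = B * P⁻¹ := by rw [← Matrix.mul_assoc, Matrix.nonsing_inv_mul P hP, Matrix.one_mul]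

/-- Reflexivity of `GL₃(ℤ)`-conjugacy. [folklore] -/
private theorem conj_refl (B : Matrix (Fin 3) (Fin 3) ℤ) :
    ∃ P : Matrix (Fin 3) (Fin 3) ℤ, IsUnit P.det ∧ P * B = B * P :=
  ⟨1, by simp, by rw [Matrix.one_mul, Matrix.mul_one]⟩

/-! ## §1 The forms `T(x, y, z) = (0 x y; 0 α z; 0 0 0)` -/

/-- The forms have characteristic polynomial `t²(t − α)` (a `2 × 2` block of eigenvalue `0`, a `1 × 1` block of
eigenvalue `α`, when `α ≠ 0` and `T² ≠ αT`). [cite: HertlingLarabi2026b, §11 (11.9), chunk p0037] -/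
theorem charpoly_form (α x y z : ℤ) :
    (!![0, x, y; 0, α, z; 0, 0, 0] : Matrix (Fin 3) (Fin 3) ℤ).charpoly = X ^ 2 * (X - C α) := by
  rw [charpoly_triangular]
  simp only [map_zero, sub_zero]
  ring

/-- `T² − αT = (xz − αy)·E₁₃`: the only obstruction to `t(t − α)` annihilating `T`.
[cite: HertlingLarabi2026b, §11 (11.9), chunk p0037] -/
theorem mul_self_sub_smul (α x y z : ℤ) :
    (!![0, x, y; 0, α, z; 0, 0, 0] : Matrix (Fin 3) (Fin 3) ℤ) * !![0, x, y; 0, α, z; 0, 0, 0] -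
        α • !![0, x, y; 0, α, z; 0, 0, 0] = !![0, 0, x * z - α * y; 0, 0, 0; 0, 0, 0] := by
  ext i j
  fin_cases i <;> fin_cases j <;> simp
  ring

/-- `T² = αT ⟺ αy − xz = 0`; so `T` has minimal polynomial `t²(t − α)` (a genuine `2 × 2` Jordan block) iff
`αy − xz ≠ 0`. [cite: HertlingLarabi2026b, §11 (11.9), chunk p0037] -/
theorem mul_self_eq_smul_iff (α x y z : ℤ) :
    (!![0, x, y; 0, α, z; 0, 0, 0] : Matrix (Fin 3) (Fin 3) ℤ) * !![0, x, y; 0, α, z; 0, 0, 0] =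
        α • !![0, x, y; 0, α, z; 0, 0, 0] ↔ α * y - x * z = 0 := by
  rw [← sub_eq_zero, mul_self_sub_smul]
  constructor
  · intro h
    have := congr_fun (congr_fun h 0) 2
    simp at this
    linear_combination -this
  · intro h
    ext i j
    fin_cases i <;> fin_cases j <;> simp
    linear_combination -h

/-- The relation `N² = αN` is transported by `GL₃(ℤ)`-conjugation (indeed by any `P` with `det P` a unit).
[folklore] -/
private theorem mul_self_eq_smul_iff_of_conj {N M P : Matrix (Fin 3) (Fin 3) ℤ} (hP : IsUnit P.det)
    (h : P * N = M * P) (α : ℤ) : N * N = α • N ↔ M * M = α • M := by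
  have hu : IsUnit P := (Matrix.isUnit_iff_isUnit_det P).2 hP
  have h2 : P * (N * N) = M * M * P := by
    rw [← Matrix.mul_assoc, h, Matrix.mul_assoc, h, Matrix.mul_assoc]
  have h1 : P * (α • N) = α • M * P := by
    rw [Matrix.mul_smul, h, Matrix.smul_mul]
  constructor
  · intro hN
    rw [hN, h1] at h2
    exact (hu.mul_left_inj.1 h2).symm
  · intro hM
    rw [hM, ← h1] at h2
    exact hu.mul_right_inj.1 h2

/-! ## §2 Conjugators between forms are upper triangular; the invariant `|αy − xz|` -/

/-- **A conjugator between two forms is upper triangular**: if `P·T(x, y, z) = T(x′, y′, z′)·P` with `α ≠ 0` and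
`αy − xz ≠ 0`, then `P₁₀ = P₂₀ = P₂₁ = 0` (the flag `ker T = ℤe₁ ⊂ ker T(T − α) = ℤe₁ ⊕ ℤe₂` is preserved) and the
remaining entry equations read `x′P₁₁ = P₀₀x + P₀₁α`, `P₁₁z = αP₁₂ + z′P₂₂`, `P₀₀y + P₀₁z = x′P₁₂ + y′P₂₂`.
[cite: HertlingLarabi2026b, §11 Lemma 11.1 (c) («no further reductions are possible»), chunk p0038] -/
theorem upper_of_conj {α x y z x' y' z' : ℤ} (hα : α ≠ 0) (hd : α * y - x * z ≠ 0) {P : Matrix (Fin 3) (Fin 3) ℤ}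
    (h : P * !![0, x, y; 0, α, z; 0, 0, 0] = !![0, x', y'; 0, α, z'; 0, 0, 0] * P) :
    P 1 0 = 0 ∧ P 2 0 = 0 ∧ P 2 1 = 0 ∧ x' * P 1 1 = P 0 0 * x + P 0 1 * α ∧
      P 1 1 * z = α * P 1 2 + z' * P 2 2 ∧ P 0 0 * y + P 0 1 * z = x' * P 1 2 + y' * P 2 2 := by
  have e := fun i j => congr_fun (congr_fun h i) j
  -- row `2` of `PT` vanishes: `P₂₀x + P₂₁α = 0`, `P₂₀y + P₂₁z = 0`
  have e21 : P 2 0 * x + P 2 1 * α = 0 := by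
    have := e 2 1; simp [Matrix.mul_apply, Fin.sum_univ_three] at this; linear_combination this
  have e22 : P 2 0 * y + P 2 1 * z = 0 := by
    have := e 2 2; simp [Matrix.mul_apply, Fin.sum_univ_three] at this; linear_combination this
  have h20 : P 2 0 = 0 := by
    have : P 2 0 * (α * y - x * z) = 0 := by linear_combination α * e22 - z * e21
    exact (mul_eq_zero.1 this).resolve_right hd
  have h21 : P 2 1 = 0 := by
    have : P 2 1 * α = 0 := by rw [h20, zero_mul, zero_add] at e21; exact e21
    exact (mul_eq_zero.1 this).resolve_right hα
  -- column `0` of `T'P` vanishes: `αP₁₀ + z′P₂₀ = 0`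
  have h10 : P 1 0 = 0 := by
    have := e 1 0
    simp [Matrix.mul_apply, Fin.sum_univ_three, h20] at this
    rcases this with h | h
    · exact absurd h hα
    · exact h
  refine ⟨h10, h20, h21, ?_, ?_, ?_⟩
  · have := e 0 1
    simp [Matrix.mul_apply, Fin.sum_univ_three, h21] at this
    linear_combination -this
  · have := e 1 2
    simp [Matrix.mul_apply, Fin.sum_univ_three, h10] at this
    linear_combination this
  · have := e 0 2
    simp [Matrix.mul_apply, Fin.sum_univ_three] at this
    linear_combination this

/-- The diagonal of such a conjugator consists of units: `P₀₀² = P₁₁² = P₂₂² = 1` (it is upper triangular with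
`det P = P₀₀P₁₁P₂₂ = ±1`). [cite: HertlingLarabi2026b, §11 Lemma 11.1 (c) («no further reductions are possible»), chunk p0038] -/
theorem diag_mul_self_eq_one_of_conj {α x y z x' y' z' : ℤ} (hα : α ≠ 0) (hd : α * y - x * z ≠ 0)
    {P : Matrix (Fin 3) (Fin 3) ℤ} (hP : IsUnit P.det)
    (h : P * !![0, x, y; 0, α, z; 0, 0, 0] = !![0, x', y'; 0, α, z'; 0, 0, 0] * P) :
    P 0 0 * P 0 0 = 1 ∧ P 1 1 * P 1 1 = 1 ∧ P 2 2 * P 2 2 = 1 := by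
  obtain ⟨h10, h20, h21, -⟩ := upper_of_conj hα hd h
  have hdet : P.det = P 0 0 * P 1 1 * P 2 2 := by
    rw [Matrix.det_fin_three, h10, h20, h21]; ring
  rw [hdet] at hP
  exact ⟨Int.isUnit_mul_self (isUnit_of_mul_isUnit_left (isUnit_of_mul_isUnit_left hP)),
    Int.isUnit_mul_self (isUnit_of_mul_isUnit_right (isUnit_of_mul_isUnit_left hP)),
    Int.isUnit_mul_self (isUnit_of_mul_isUnit_right hP)⟩

/-- **The invariant**: if `P·T(x, y, z) = T(x′, y′, z′)·P` with `P ∈ GL₃(ℤ)`, then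
`αy′ − x′z′ = P₀₀P₂₂·(αy − xz)` — in HL's dictionary `αy − xz = α/δ₂ = α/α₂` with `α₂` the invariant of the order
`𝒪(L)` (Lemma 11.1 (e): `α₂ = δ₂`). [cite: HertlingLarabi2026b, §11 Lemma 11.1 (e)–(f), chunk p0037] -/
theorem sub_mul_eq_of_conj {α x y z x' y' z' : ℤ} (hα : α ≠ 0) (hd : α * y - x * z ≠ 0)
    {P : Matrix (Fin 3) (Fin 3) ℤ} (hP : IsUnit P.det)
    (h : P * !![0, x, y; 0, α, z; 0, 0, 0] = !![0, x', y'; 0, α, z'; 0, 0, 0] * P) :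
    α * y' - x' * z' = P 0 0 * P 2 2 * (α * y - x * z) := by
  obtain ⟨-, -, -, e01, e12, e02⟩ := upper_of_conj hα hd h
  obtain ⟨-, u1, u2⟩ := diag_mul_self_eq_one_of_conj hα hd hP h
  have hz' : z' = P 2 2 * (P 1 1 * z - α * P 1 2) := by
    linear_combination (-z') * u2 - P 2 2 * e12
  have hy' : y' = P 2 2 * (P 0 0 * y + P 0 1 * z - x' * P 1 2) := by
    linear_combination (-y') * u2 - P 2 2 * e02
  rw [hz', hy']
  linear_combination (-(P 2 2 * z)) * e01

/-- Hence `|αy − xz|` is a `GL₃(ℤ)`-class invariant of the forms. [cite: HertlingLarabi2026b, §11 Lemma 11.1 (e)–(f), chunk p0037] -/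
theorem natAbs_sub_mul_eq_of_conj {α x y z x' y' z' : ℤ} (hα : α ≠ 0) (hd : α * y - x * z ≠ 0)
    (h : ∃ P : Matrix (Fin 3) (Fin 3) ℤ, IsUnit P.det ∧
      P * !![0, x, y; 0, α, z; 0, 0, 0] = !![0, x', y'; 0, α, z'; 0, 0, 0] * P) :
    (α * y' - x' * z').natAbs = (α * y - x * z).natAbs := by
  obtain ⟨P, hP, h⟩ := h
  obtain ⟨u0, -, u2⟩ := diag_mul_self_eq_one_of_conj hα hd hP h
  rw [sub_mul_eq_of_conj hα hd hP h, Int.natAbs_mul, Int.natAbs_mul]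
  have h0 : (P 0 0).natAbs = 1 := Int.isUnit_iff_natAbs_eq.1 (IsUnit.of_mul_eq_one _ u0)
  have h2 : (P 2 2).natAbs = 1 := Int.isUnit_iff_natAbs_eq.1 (IsUnit.of_mul_eq_one _ u2)
  rw [h0, h2, one_mul, one_mul]

/-! ## §3 The moves, specialised to the diagonal `(0, α, 0)` -/

/-- `x ↦ x + kα`, `y ↦ y + kz` (shear `1 + ke₁₂`). [cite: HertlingLarabi2026b, §11 proof of Lemma 11.1 (c), chunk p0038] -/
theorem shear₁₂_conj (α x y z k : ℤ) :
    ∃ P : Matrix (Fin 3) (Fin 3) ℤ, IsUnit P.det ∧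
      P * !![0, x, y; 0, α, z; 0, 0, 0] = !![0, x + k * α, y + k * z; 0, α, z; 0, 0, 0] * P := by
  simpa using triangular_shear₁₂_conj 0 α 0 x y z k

/-- `z ↦ z − kα`, `y ↦ y − kx` (shear `1 + ke₂₃`). [cite: HertlingLarabi2026b, §11 proof of Lemma 11.1 (c), chunk p0038] -/
theorem shear₂₃_conj (α x y z k : ℤ) :
    ∃ P : Matrix (Fin 3) (Fin 3) ℤ, IsUnit P.det ∧
      P * !![0, x, y; 0, α, z; 0, 0, 0] = !![0, x, y - k * x; 0, α, z - k * α; 0, 0, 0] * P := by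
  have h := triangular_shear₂₃_conj 0 α 0 x y z k
  simp only [zero_sub, mul_neg, ← sub_eq_add_neg] at h
  exact h

/-- `(x, y, z) ↦ (x, −y, −z)` (signs `diag(1, 1, −1)`; it flips the sign of `αy − xz`).
[cite: HertlingLarabi2026b, §11 proof of Lemma 11.1 (c) (the units `±e₁ + e₂`), chunk p0038] -/
theorem sign₃_conj (α x y z : ℤ) :
    ∃ P : Matrix (Fin 3) (Fin 3) ℤ, IsUnit P.det ∧
      P * !![0, x, y; 0, α, z; 0, 0, 0] = !![0, x, -y; 0, α, -z; 0, 0, 0] * P := by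
  simpa using triangular_diag_conj 0 α 0 x y z (ε₁ := 1) (ε₂ := 1) (ε₃ := -1) (by norm_num) (by norm_num)
    (by norm_num)

/-- `(x, y, z) ↦ (−x, y, −z)` (signs `diag(1, −1, 1)`; it keeps `αy − xz`).
[cite: HertlingLarabi2026b, §11 proof of Lemma 11.1 (c) (the unit `−e₁ + e₂`), chunk p0038] -/
theorem sign₂_conj (α x y z : ℤ) :
    ∃ P : Matrix (Fin 3) (Fin 3) ℤ, IsUnit P.det ∧
      P * !![0, x, y; 0, α, z; 0, 0, 0] = !![0, -x, y; 0, α, -z; 0, 0, 0] * P := by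
  simpa using triangular_diag_conj 0 α 0 x y z (ε₁ := 1) (ε₂ := -1) (ε₃ := 1) (by norm_num) (by norm_num)
    (by norm_num)

/-! ## §4 Existence of the normal form (Lemma 11.1 (c) with (f)(ii)) -/

/-- Step 1: make `αy − xz` positive (the sign move `diag(1, 1, −1)` if necessary). [cite: HertlingLarabi2026b, §11 Lemma 11.1 (c), chunk p0038] -/
private theorem step_pos {α x y z : ℤ} (hd : α * y - x * z ≠ 0) :
    ∃ y' z' : ℤ, 0 < α * y' - x * z' ∧ ∃ P : Matrix (Fin 3) (Fin 3) ℤ, IsUnit P.det ∧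
      P * !![0, x, y; 0, α, z; 0, 0, 0] = !![0, x, y'; 0, α, z'; 0, 0, 0] * P := by
  rcases lt_or_gt_of_ne hd with h | h
  · exact ⟨-y, -z, by linarith, sign₃_conj α x y z⟩
  · exact ⟨y, z, h, conj_refl _⟩

/-- Step 2: bring `z` into `[0, α/2]` — first `z ↦ z mod α ∈ [0, α)` by `1 + ke₂₃`, then, if `z > α/2`, the sign
move `diag(1, −1, 1)` followed by `z ↦ z + α` (HL: `δ₁ ∈ [0, ½]` by Theorem 9.1 (b) for `pr_F L`).
[cite: HertlingLarabi2026b, §11 proof of Lemma 11.1 (c), chunk p0038] -/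
private theorem step_z {α x y z : ℤ} (hα : 0 < α) (hd : 0 < α * y - x * z) :
    ∃ x' y' z' : ℤ, 0 < α * y' - x' * z' ∧ 0 ≤ z' ∧ 2 * z' ≤ α ∧ ∃ P : Matrix (Fin 3) (Fin 3) ℤ, IsUnit P.det ∧
      P * !![0, x, y; 0, α, z; 0, 0, 0] = !![0, x', y'; 0, α, z'; 0, 0, 0] * P := by
  have hz₁ : z - z / α * α = z % α := by rw [Int.emod_def]; ring
  have h0 : 0 ≤ z % α := Int.emod_nonneg _ hα.ne'
  have h1 : z % α < α := Int.emod_lt_of_pos _ hα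
  have hc₁ := shear₂₃_conj α x y z (z / α)
  rw [hz₁] at hc₁
  have hd₁ : α * (y - z / α * x) - x * (z % α) = α * y - x * z := by rw [← hz₁]; ring
  by_cases h2 : 2 * (z % α) ≤ α
  · exact ⟨x, y - z / α * x, z % α, by rw [hd₁]; exact hd, h0, h2, hc₁⟩
  · have hc₂ := sign₂_conj α x (y - z / α * x) (z % α)
    have hc₃ := shear₂₃_conj α (-x) (y - z / α * x) (-(z % α)) (-1)
    refine ⟨-x, y - z / α * x - (-1) * (-x), -(z % α) - (-1) * α, ?_, by linarith, by linarith,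
      conj_trans hc₁ (conj_trans hc₂ hc₃)⟩
    have e : α * (y - z / α * x - (-1) * (-x)) - (-x) * (-(z % α) - (-1) * α) =
        α * (y - z / α * x) - x * (z % α) := by ring
    rw [e, hd₁]; exact hd

/-- Step 3: bring `x` into the window `−α ≤ 2x < α` (a full residue system modulo `α`) by `1 + ke₁₂`; `z` and
`αy − xz` are unchanged (HL: `δ₃ ∈ (−½δ₂, ½δ₂]`). [cite: HertlingLarabi2026b, §11 proof of Lemma 11.1 (c), chunk p0038] -/
private theorem step_x {α z : ℤ} (x y : ℤ) (hα : 0 < α) :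
    ∃ x' y' : ℤ, -α ≤ 2 * x' ∧ 2 * x' < α ∧ α * y' - x' * z = α * y - x * z ∧
      ∃ P : Matrix (Fin 3) (Fin 3) ℤ, IsUnit P.det ∧
        P * !![0, x, y; 0, α, z; 0, 0, 0] = !![0, x', y'; 0, α, z; 0, 0, 0] * P := by
  have e : x + -((x + α / 2) / α) * α = (x + α / 2) % α - α / 2 := by rw [Int.emod_def]; ring
  have h0 : 0 ≤ (x + α / 2) % α := Int.emod_nonneg _ hα.ne'
  have h1 : (x + α / 2) % α < α := Int.emod_lt_of_pos _ hα
  refine ⟨x + -((x + α / 2) / α) * α, y + -((x + α / 2) / α) * z, ?_, ?_, by ring, shear₁₂_conj α x y z _⟩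
  · rw [e]
    generalize (x + α / 2) % α = r at h0 h1 ⊢
    omega
  · rw [e]
    generalize (x + α / 2) % α = r at h0 h1 ⊢
    omega

/-- Step 4 (boundary cases `z ∈ {0, α/2}`): the extra move `x ↦ −x` with `z` and `αy − xz` unchanged — for `z = 0`
the sign move `diag(1, −1, 1)`; for `2z = α` the same move followed by `z ↦ z + α` (HL: «If `δ₁ = 0` the full
lattice `(−e₁+e₂)L₃` […] If `δ₁ = ½` […] Therefore in the boundary cases […] we can choose `δ₃ ∈ [0, ½δ₂]`»).
[cite: HertlingLarabi2026b, §11 proof of Lemma 11.1 (c), chunk p0038] -/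
private theorem step_boundary {α z : ℤ} (x y : ℤ) (hz : z = 0 ∨ 2 * z = α) :
    ∃ y' : ℤ, α * y' - -x * z = α * y - x * z ∧ ∃ P : Matrix (Fin 3) (Fin 3) ℤ, IsUnit P.det ∧
      P * !![0, x, y; 0, α, z; 0, 0, 0] = !![0, -x, y'; 0, α, z; 0, 0, 0] * P := by
  rcases hz with hz | hz
  · subst hz
    refine ⟨y, by ring, ?_⟩
    simpa using sign₂_conj α x y 0
  · have h := shear₂₃_conj α (-x) y (-z) (-1)
    have e1 : y - -1 * -x = y - x := by ring
    have e2 : -z - -1 * α = z := by linarith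
    rw [e1, e2] at h
    exact ⟨y - x, by linear_combination x * hz, conj_trans (sign₂_conj α x y z) h⟩

/-- **Normal form for the forms**: every `T(x, y, z)` with `αy − xz ≠ 0` (`α ≥ 1`) is `GL₃(ℤ)`-conjugate to some
`T(x′, y′, z′)` with `αy′ − x′z′ > 0`, `0 ≤ 2z′ ≤ α`, `−α ≤ 2x′ < α`, and `x′ ≤ 0` if `z′ ∈ {0, α/2}` — the windows
(11.6) in the entries of (11.9). [cite: HertlingLarabi2026b, §11 Lemma 11.1 (c) and (f)(ii), chunks p0037–p0038] -/
theorem exists_conj_normalForm_of_form {α x y z : ℤ} (hα : 0 < α) (hd : α * y - x * z ≠ 0) :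
    ∃ x' y' z' : ℤ, (0 < α * y' - x' * z' ∧ 0 ≤ z' ∧ 2 * z' ≤ α ∧ -α ≤ 2 * x' ∧ 2 * x' < α ∧
        ((z' = 0 ∨ 2 * z' = α) → x' ≤ 0)) ∧
      ∃ P : Matrix (Fin 3) (Fin 3) ℤ, IsUnit P.det ∧
        P * !![0, x, y; 0, α, z; 0, 0, 0] = !![0, x', y'; 0, α, z'; 0, 0, 0] * P := by
  obtain ⟨y₁, z₁, hd₁, hc₁⟩ := step_pos hd
  obtain ⟨x₂, y₂, z₂, hd₂, hz0, hz2, hc₂⟩ := step_z hα hd₁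
  obtain ⟨x₃, y₃, hx1, hx2, hd₃, hc₃⟩ := step_x (z := z₂) x₂ y₂ hα
  by_cases hb : (z₂ = 0 ∨ 2 * z₂ = α) ∧ 0 < x₃
  · obtain ⟨y₄, hd₄, hc₄⟩ := step_boundary (z := z₂) x₃ y₃ hb.1
    exact ⟨-x₃, y₄, z₂, ⟨by rw [hd₄, hd₃]; exact hd₂, hz0, hz2, by omega, by omega, fun _ => by omega⟩,
      conj_trans hc₁ (conj_trans hc₂ (conj_trans hc₃ hc₄))⟩
  · refine ⟨x₃, y₃, z₂, ⟨by rw [hd₃]; exact hd₂, hz0, hz2, hx1, hx2, fun h => ?_⟩,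
      conj_trans hc₁ (conj_trans hc₂ hc₃)⟩
    by_contra hx
    exact hb ⟨h, not_le.1 hx⟩

/-- **LEMMA 11.1 (c) + (f)(ii), matrix form (existence)**: every integer `3 × 3` matrix `N` with
`χ_N = t²(t − α)`, `α ≥ 1`, and `N² ≠ αN` (a `2 × 2` Jordan block with eigenvalue `0` and a `1 × 1` Jordan block
with eigenvalue `α`) is `GL₃(ℤ)`-conjugate to a normal form `(0 x y; 0 α z; 0 0 0)` with `x, y, z ∈ ℤ`,
`αy − xz > 0`, `0 ≤ 2z ≤ α`, `−α ≤ 2x < α`, and `x ≤ 0` if `z ∈ {0, α/2}`.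
[cite: HertlingLarabi2026b, §11 Lemma 11.1 (c) and (f)(ii), chunks p0037–p0038] -/
theorem exists_conj_normalForm {α : ℤ} {N : Matrix (Fin 3) (Fin 3) ℤ} (hα : 0 < α)
    (hχ : N.charpoly = X ^ 2 * (X - C α)) (hN : N * N ≠ α • N) :
    ∃ x y z : ℤ, (0 < α * y - x * z ∧ 0 ≤ z ∧ 2 * z ≤ α ∧ -α ≤ 2 * x ∧ 2 * x < α ∧
        ((z = 0 ∨ 2 * z = α) → x ≤ 0)) ∧
      ∃ P : Matrix (Fin 3) (Fin 3) ℤ, IsUnit P.det ∧ P * N = !![0, x, y; 0, α, z; 0, 0, 0] * P := by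
  have hχ' : N.charpoly = (X - C 0) * (X - C α) * (X - C 0) := by rw [hχ, map_zero, sub_zero]; ring
  obtain ⟨a, b, c, P, hP, hPN⟩ := exists_conj_upperTriangular hχ'
  have hd : α * b - a * c ≠ 0 := fun h0 =>
    hN ((mul_self_eq_smul_iff_of_conj hP hPN α).2 ((mul_self_eq_smul_iff α a b c).2 h0))
  obtain ⟨x, y, z, hnf, hc⟩ := exists_conj_normalForm_of_form hα hd
  exact ⟨x, y, z, hnf, conj_trans ⟨P, hP, hPN⟩ hc⟩

/-! ## §5 Uniqueness of the normal form («no further reductions are possible») -/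

/-- `−α < αk < α ⟹ k = 0` (`α ≥ 1`). [folklore] -/
private theorem eq_zero_of_mul_mem_Ioo {α k : ℤ} (hα : 0 < α) (h1 : -α < α * k) (h2 : α * k < α) : k = 0 := by
  have hk1 : k < 1 := Int.lt_of_mul_lt_mul_left (by linarith : α * k < α * 1) hα.le
  have hk2 : -1 < k := Int.lt_of_mul_lt_mul_left (by linarith : α * -1 < α * k) hα.le
  omega

/-- Two members of a window of length `< α` which differ by a multiple of `α` are equal. [folklore] -/
private theorem eq_of_sub_eq_mul {α u v k : ℤ} (hα : 0 < α) (h : u - v = α * k) (h1 : -α < u - v)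
    (h2 : u - v < α) : u = v := by
  have hk := eq_zero_of_mul_mem_Ioo hα (by rw [← h]; exact h1) (by rw [← h]; exact h2)
  rw [hk, mul_zero, sub_eq_zero] at h
  exact h

/-- `u, v ∈ [0, α/2]` with `u + v ∈ αℤ` forces `u = v ∈ {0, α/2}` (the representatives of `±z mod α`). [folklore] -/
private theorem eq_of_add_eq_mul_of_nonneg {α u v k : ℤ} (hα : 0 < α) (h : u + v = α * k) (hu0 : 0 ≤ u)
    (hu : 2 * u ≤ α) (hv0 : 0 ≤ v) (hv : 2 * v ≤ α) : u = v ∧ (u = 0 ∨ 2 * u = α) := by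
  have hk1 : k < 2 := Int.lt_of_mul_lt_mul_left (by linarith : α * k < α * 2) hα.le
  have hk2 : -1 < k := Int.lt_of_mul_lt_mul_left (by linarith : α * -1 < α * k) hα.le
  have hk : k = 0 ∨ k = 1 := by omega
  rcases hk with rfl | rfl
  · rw [mul_zero] at h
    exact ⟨by omega, Or.inl (by omega)⟩
  · rw [mul_one] at h
    exact ⟨by omega, Or.inr (by omega)⟩

/-- `u, v ∈ [−α/2, 0]` with `u + v ∈ αℤ` forces `u = v` (the representatives of `±x mod α` in the boundary cases).
[folklore] -/
private theorem eq_of_add_eq_mul_of_nonpos {α u v k : ℤ} (hα : 0 < α) (h : u + v = α * k) (hu : -α ≤ 2 * u)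
    (hu0 : u ≤ 0) (hv : -α ≤ 2 * v) (hv0 : v ≤ 0) : u = v := by
  have hk1 : k < 1 := Int.lt_of_mul_lt_mul_left (by linarith : α * k < α * 1) hα.le
  have hk2 : -2 < k := Int.lt_of_mul_lt_mul_left (by linarith : α * -2 < α * k) hα.le
  have hk : k = -1 ∨ k = 0 := by omega
  rcases hk with rfl | rfl
  · rw [mul_neg_one] at h
    omega
  · rw [mul_zero] at h
    omega

/-- **LEMMA 11.1 (c), matrix form (uniqueness)**: two normal forms `T(x, y, z)`, `T(x′, y′, z′)` (windows as in
`exists_conj_normalForm`) which are `GL₃(ℤ)`-conjugate are EQUAL («We leave it to the reader to show that no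
further reductions are possible»).  Proof: a conjugator `P` is upper triangular with diagonal `(ε₀, ε₁, ε₂)`,
`εᵢ = ±1` (§2); `αy′ − x′z′ = ε₀ε₂(αy − xz)` forces `ε₀ = ε₂`; the entry equations give `z′ ≡ ε₁ε₂z` and
`x′ ≡ ε₀ε₁x (mod α)`, and the windows leave only `z′ = z`, `x′ = x` (with `ε₁ ≠ ε₂` possible only in the boundary
cases `z ∈ {0, α/2}`, where `x, x′ ≤ 0`). [cite: HertlingLarabi2026b, §11 Lemma 11.1 (c), chunk p0038] -/
theorem normalForm_unique {α x y z x' y' z' : ℤ} (hα : 0 < α)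
    (h : 0 < α * y - x * z ∧ 0 ≤ z ∧ 2 * z ≤ α ∧ -α ≤ 2 * x ∧ 2 * x < α ∧ ((z = 0 ∨ 2 * z = α) → x ≤ 0))
    (h' : 0 < α * y' - x' * z' ∧ 0 ≤ z' ∧ 2 * z' ≤ α ∧ -α ≤ 2 * x' ∧ 2 * x' < α ∧
      ((z' = 0 ∨ 2 * z' = α) → x' ≤ 0))
    (hconj : ∃ P : Matrix (Fin 3) (Fin 3) ℤ, IsUnit P.det ∧
      P * !![0, x, y; 0, α, z; 0, 0, 0] = !![0, x', y'; 0, α, z'; 0, 0, 0] * P) :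
    x = x' ∧ y = y' ∧ z = z' := by
  obtain ⟨hd, hz0, hz2, hx1, hx2, hbd⟩ := h
  obtain ⟨hd', hz0', hz2', hx1', hx2', hbd'⟩ := h'
  obtain ⟨P, hP, hc⟩ := hconj
  obtain ⟨-, -, -, e01, e12, -⟩ := upper_of_conj hα.ne' hd.ne' hc
  obtain ⟨u0, u1, u2⟩ := diag_mul_self_eq_one_of_conj hα.ne' hd.ne' hP hc
  have hdd := sub_mul_eq_of_conj hα.ne' hd.ne' hP hc
  have h00 : P 0 0 = 1 ∨ P 0 0 = -1 := (Int.eq_one_or_neg_one_of_mul_eq_one' u0).imp And.left And.left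
  have h11 : P 1 1 = 1 ∨ P 1 1 = -1 := (Int.eq_one_or_neg_one_of_mul_eq_one' u1).imp And.left And.left
  have h22 : P 2 2 = 1 ∨ P 2 2 = -1 := (Int.eq_one_or_neg_one_of_mul_eq_one' u2).imp And.left And.left
  -- `ε₀ = ε₂` since both invariants are positive
  have h02 : P 0 0 = P 2 2 := by
    rcases h00 with h0 | h0 <;> rcases h22 with h2 | h2 <;>
      simp only [h0, h2, one_mul, mul_one, neg_one_mul, mul_neg_one, neg_neg] at hdd ⊢ <;> linarith
  -- the key: `x = x'` and `z = z'`
  have hxz : x = x' ∧ z = z' := by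
    rw [h02] at e01
    rcases h11 with h1 | h1 <;> rcases h22 with h2 | h2 <;>
      simp only [h1, h2, one_mul, mul_one, neg_one_mul, mul_neg_one] at e01 e12
    · -- `ε₁ = ε₂ = 1`: differences
      have hz : z = z' := eq_of_sub_eq_mul hα (k := P 1 2) (by linear_combination e12) (by omega) (by omega)
      have hx : x' = x := eq_of_sub_eq_mul hα (k := P 0 1) (by linear_combination e01) (by omega) (by omega)
      exact ⟨hx.symm, hz⟩
    · -- `ε₁ = 1`, `ε₂ = −1`: sums, boundary case
      obtain ⟨hz, hb⟩ := eq_of_add_eq_mul_of_nonneg hα (k := P 1 2) (u := z) (v := z')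
        (by linear_combination e12) hz0 hz2 hz0' hz2'
      have hb' : z' = 0 ∨ 2 * z' = α := by rw [← hz]; exact hb
      have hx : x = x' := eq_of_add_eq_mul_of_nonpos hα (k := P 0 1) (by linear_combination e01) hx1 (hbd hb)
        hx1' (hbd' hb')
      exact ⟨hx, hz⟩
    · -- `ε₁ = −1`, `ε₂ = 1`: sums, boundary case
      obtain ⟨hz, hb⟩ := eq_of_add_eq_mul_of_nonneg hα (k := -P 1 2) (u := z) (v := z')
        (by linear_combination -e12) hz0 hz2 hz0' hz2'
      have hb' : z' = 0 ∨ 2 * z' = α := by rw [← hz]; exact hb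
      have hx : x = x' := eq_of_add_eq_mul_of_nonpos hα (k := -P 0 1) (by linear_combination -e01) hx1
        (hbd hb) hx1' (hbd' hb')
      exact ⟨hx, hz⟩
    · -- `ε₁ = ε₂ = −1`: differences
      have hz : z' = z := eq_of_sub_eq_mul hα (k := P 1 2) (by linear_combination e12) (by omega) (by omega)
      have hx : x = x' := eq_of_sub_eq_mul hα (k := P 0 1) (by linear_combination e01) (by omega) (by omega)
      exact ⟨hx, hz.symm⟩
  obtain ⟨hx, hz⟩ := hxz
  refine ⟨hx, ?_, hz⟩
  -- `y` from the invariant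
  have h0022 : P 0 0 * P 2 2 = 1 := by rw [h02]; exact u2
  rw [h0022, one_mul, ← hx, ← hz] at hdd
  have : α * y' = α * y := by linear_combination hdd
  exact (mul_left_cancel₀ hα.ne' this).symm

/-! ## §6 The classification: `∃!`, the bijection with the explicit set of triples, infinitely many classes -/

/-- **LEMMA 11.1 (c) + (f)(ii), matrix form**: for `N` with `χ_N = t²(t − α)` (`α ≥ 1`) and `N² ≠ αN` there is
EXACTLY ONE `(x, y, z) ∈ ℤ³` with `αy − xz > 0`, `0 ≤ 2z ≤ α`, `−α ≤ 2x < α`, `x ≤ 0` if `z ∈ {0, α/2}`, and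
`N ∼ (0 x y; 0 α z; 0 0 0)` — «a normal form for each `GL₃(ℤ)`-conjugacy class of integer `3×3` matrices with a
`2×2` Jordan block with eigenvalues `0` and a `1×1` Jordan block with eigenvalue `α ∈ ℕ`».
[cite: HertlingLarabi2026b, §11 Lemma 11.1 (c) and (f)(ii), chunks p0037–p0038] -/
theorem existsUnique_conj_normalForm {α : ℤ} {N : Matrix (Fin 3) (Fin 3) ℤ} (hα : 0 < α)
    (hχ : N.charpoly = X ^ 2 * (X - C α)) (hN : N * N ≠ α • N) :
    ∃! t : ℤ × ℤ × ℤ, (0 < α * t.2.1 - t.1 * t.2.2 ∧ 0 ≤ t.2.2 ∧ 2 * t.2.2 ≤ α ∧ -α ≤ 2 * t.1 ∧ 2 * t.1 < α ∧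
        ((t.2.2 = 0 ∨ 2 * t.2.2 = α) → t.1 ≤ 0)) ∧
      ∃ P : Matrix (Fin 3) (Fin 3) ℤ, IsUnit P.det ∧ P * N = !![0, t.1, t.2.1; 0, α, t.2.2; 0, 0, 0] * P := by
  obtain ⟨x, y, z, hnf, hconj⟩ := exists_conj_normalForm hα hχ hN
  refine ⟨(x, y, z), ⟨hnf, hconj⟩, ?_⟩
  rintro ⟨x', y', z'⟩ ⟨hnf', hconj'⟩
  obtain ⟨e₁, e₂, e₃⟩ := normalForm_unique hα hnf' hnf (conj_trans (conj_symm hconj') hconj)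
  subst e₁ e₂ e₃
  rfl

/-- The normal forms lie in the class set: `χ = t²(t − α)` and `T² ≠ αT`. [cite: HertlingLarabi2026b, §11 (11.9), chunk p0037] -/
theorem normalForm_mem {α x y z : ℤ} (hd : 0 < α * y - x * z) :
    (!![0, x, y; 0, α, z; 0, 0, 0] : Matrix (Fin 3) (Fin 3) ℤ).charpoly = X ^ 2 * (X - C α) ∧
      (!![0, x, y; 0, α, z; 0, 0, 0] : Matrix (Fin 3) (Fin 3) ℤ) * !![0, x, y; 0, α, z; 0, 0, 0] ≠
        α • !![0, x, y; 0, α, z; 0, 0, 0] :=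
  ⟨charpoly_form α x y z, fun h => hd.ne' ((mul_self_eq_smul_iff α x y z).1 h)⟩

/-- **The classification as a BIJECTION** (HL's «1:1» of Theorem 6.3 composed with Lemma 11.1 (c)/(f)): for
`α ≥ 1`, `[N]_ℤ ↦ (x, y, z)` is a bijection from the `GL₃(ℤ)`-conjugacy classes of integer `3 × 3` matrices with
`χ_N = t²(t − α)`, `N² ≠ αN` onto the explicit set
`{(x, y, z) ∈ ℤ³ | αy − xz > 0, 0 ≤ 2z ≤ α, −α ≤ 2x < α, (z = 0 ∨ 2z = α) → x ≤ 0}`, with value `(x, y, z)` on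
the class of `(0 x y; 0 α z; 0 0 0)` — an explicit form of «(We do not list the triples `(δ₁, δ₂, δ₃)` in (11.6)
with `M_𝓑 ∈ M_{3×3}(ℤ)` in a more explicit way.)». [cite: HertlingLarabi2026b, §11 Lemma 11.1 (f)(ii), chunk p0037] -/
theorem exists_bijective_quot_conj {α : ℤ} (hα : 0 < α) :
    ∃ F : (Quot fun N N' : {N : Matrix (Fin 3) (Fin 3) ℤ // N.charpoly = X ^ 2 * (X - C α) ∧ N * N ≠ α • N} =>
        ∃ P : Matrix (Fin 3) (Fin 3) ℤ, IsUnit P.det ∧ P * N.1 = N'.1 * P) →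
      {t : ℤ × ℤ × ℤ // 0 < α * t.2.1 - t.1 * t.2.2 ∧ 0 ≤ t.2.2 ∧ 2 * t.2.2 ≤ α ∧ -α ≤ 2 * t.1 ∧ 2 * t.1 < α ∧
        ((t.2.2 = 0 ∨ 2 * t.2.2 = α) → t.1 ≤ 0)},
      Function.Bijective F ∧ ∀ (x y z : ℤ) (h : 0 < α * y - x * z ∧ 0 ≤ z ∧ 2 * z ≤ α ∧ -α ≤ 2 * x ∧
        2 * x < α ∧ ((z = 0 ∨ 2 * z = α) → x ≤ 0)) (hN),
        F (Quot.mk _ ⟨!![0, x, y; 0, α, z; 0, 0, 0], hN⟩) = ⟨(x, y, z), h⟩ := by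
  set S := {N : Matrix (Fin 3) (Fin 3) ℤ // N.charpoly = X ^ 2 * (X - C α) ∧ N * N ≠ α • N}
  set I := {t : ℤ × ℤ × ℤ // 0 < α * t.2.1 - t.1 * t.2.2 ∧ 0 ≤ t.2.2 ∧ 2 * t.2.2 ≤ α ∧ -α ≤ 2 * t.1 ∧
    2 * t.1 < α ∧ ((t.2.2 = 0 ∨ 2 * t.2.2 = α) → t.1 ≤ 0)}
  set r : S → S → Prop := fun N N' => ∃ P : Matrix (Fin 3) (Fin 3) ℤ, IsUnit P.det ∧ P * N.1 = N'.1 * P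
    with hr_def
  have hr : Equivalence r := equivalence_conj _
  set Nm : I → S := fun t => ⟨!![0, t.1.1, t.1.2.1; 0, α, t.1.2.2; 0, 0, 0], normalForm_mem t.2.1⟩ with hNm_def
  have hex : ∀ N : S, ∃ t : I, r N (Nm t) := fun N => by
    obtain ⟨x, y, z, hnf, hconj⟩ := exists_conj_normalForm hα N.2.1 N.2.2
    exact ⟨⟨(x, y, z), hnf⟩, hconj⟩
  choose f hf using hex
  have hU : ∀ t t' : I, r (Nm t) (Nm t') → t = t' := by
    rintro ⟨⟨x, y, z⟩, hnf⟩ ⟨⟨x', y', z'⟩, hnf'⟩ h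
    obtain ⟨e₁, e₂, e₃⟩ := normalForm_unique hα hnf hnf' h
    subst e₁ e₂ e₃
    rfl
  have hwd : ∀ N N' : S, r N N' → f N = f N' := fun N N' h =>
    hU _ _ (hr.trans (hr.trans (hr.symm (hf N)) h) (hf N'))
  have hval : ∀ t : I, ∀ hN, Quot.lift f hwd (Quot.mk _ ⟨_, hN⟩) = t := fun t hN =>
    hU _ _ (hr.trans (hr.symm (hf ⟨_, hN⟩)) (hr.refl (Nm t)))
  refine ⟨Quot.lift f hwd, ⟨?_, fun t => ⟨Quot.mk r (Nm t), hval t (Nm t).2⟩⟩,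
    fun x y z h hN => hval ⟨(x, y, z), h⟩ hN⟩
  rintro ⟨N⟩ ⟨N'⟩ h
  change f N = f N' at h
  exact Quot.sound (hr.trans (hf N) (h ▸ hr.symm (hf N')))

/-- **Infinitely many classes for every `α`**: the normal forms `T(0, y, 0)`, `y = 1, 2, 3, …` are pairwise
non-conjugate (the invariant `αy − xz = αy` separates them) — as Theorem 6.4 (c) predicts for the non-semisimple
Jordan type `(2, 1)` («If `C` is not semisimple then `M_{n×n}(ℤ) ∩ [C]_ℂ` splits into infinitely many `GL_n(ℤ)`-conjugacy classes»). [cite: HertlingLarabi2026b, §6 Thm. 6.4 (c) (chunk p0013) and §11 Lemma 11.1 (c) (chunk p0037)] -/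
theorem infinite_quot_conj {α : ℤ} (hα : 0 < α) :
    Infinite (Quot fun N N' : {N : Matrix (Fin 3) (Fin 3) ℤ // N.charpoly = X ^ 2 * (X - C α) ∧ N * N ≠ α • N} =>
      ∃ P : Matrix (Fin 3) (Fin 3) ℤ, IsUnit P.det ∧ P * N.1 = N'.1 * P) := by
  have hnf : ∀ n : ℕ, 0 < α * ((n : ℤ) + 1) - 0 * 0 ∧ (0 : ℤ) ≤ 0 ∧ 2 * (0 : ℤ) ≤ α ∧ -α ≤ 2 * (0 : ℤ) ∧
      2 * (0 : ℤ) < α ∧ (((0 : ℤ) = 0 ∨ 2 * (0 : ℤ) = α) → (0 : ℤ) ≤ 0) := fun n =>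
    ⟨by nlinarith, le_rfl, by linarith, by linarith, by linarith, fun _ => le_rfl⟩
  refine Infinite.of_injective (fun n : ℕ => Quot.mk _
    ⟨!![0, 0, (n : ℤ) + 1; 0, α, 0; 0, 0, 0], normalForm_mem (hnf n).1⟩) fun n m h => ?_
  have h' := (Equivalence.eqvGen_iff (equivalence_conj _)).1 (Quot.eqvGen_exact h)
  obtain ⟨-, e, -⟩ := normalForm_unique hα (hnf n) (hnf m) h'
  exact_mod_cast (add_left_injective _ e : (n : ℤ) = m)

/-! ## §7 The general Jordan type `(2, 1)`: eigenvalues `λ` (the `2 × 2` block) and `μ ≠ λ` -/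

/-- `(λ sx sy; 0 μ sz; 0 0 λ) = λ·1 + s·T_α(x, y, z)` when `μ = λ + sα`. [folklore] -/
private theorem genForm_eq (l μ s α x y z : ℤ) (hμ : μ = l + s * α) :
    (!![l, s * x, s * y; 0, μ, s * z; 0, 0, l] : Matrix (Fin 3) (Fin 3) ℤ) =
      l • (1 : Matrix (Fin 3) (Fin 3) ℤ) + s • !![0, x, y; 0, α, z; 0, 0, 0] := by
  ext i j
  rw [Matrix.add_apply, Matrix.smul_apply, Matrix.smul_apply, smul_eq_mul, smul_eq_mul, Matrix.one_apply]
  fin_cases i <;> fin_cases j <;> simp [hμ]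

/-- Conjugation commutes with `M ↦ λ·1 + s·M` for `s = ±1`. [folklore] -/
private theorem conj_affine_iff {A B P : Matrix (Fin 3) (Fin 3) ℤ} (l s : ℤ) (hs : s * s = 1) :
    P * (l • (1 : Matrix (Fin 3) (Fin 3) ℤ) + s • A) = (l • (1 : Matrix (Fin 3) (Fin 3) ℤ) + s • B) * P ↔
      P * A = B * P := by
  rw [Matrix.mul_add, Matrix.add_mul, Matrix.mul_smul, Matrix.smul_mul, Matrix.mul_one, Matrix.one_mul,
    add_right_inj, Matrix.mul_smul, Matrix.smul_mul]
  constructor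
  · intro h
    have h2 := congr_arg (fun M : Matrix (Fin 3) (Fin 3) ℤ => s • M) h
    simp only [smul_smul, hs, one_smul] at h2
    exact h2
  · intro h
    rw [h]

/-- Conjugation transports `N − l·1`. [folklore] -/
private theorem conj_sub_smul_one {N U P : Matrix (Fin 3) (Fin 3) ℤ} (h : P * N = U * P) (l : ℤ) :
    P * (N - l • (1 : Matrix (Fin 3) (Fin 3) ℤ)) = (U - l • (1 : Matrix (Fin 3) (Fin 3) ℤ)) * P := by
  rw [Matrix.mul_sub, Matrix.sub_mul, h, Matrix.mul_smul, Matrix.smul_mul, Matrix.mul_one, Matrix.one_mul]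

/-- `(U − λ)(U − μ) = (ac − (μ − λ)b)·E₁₃` for `U = (λ a b; 0 μ c; 0 0 λ)`. [folklore] -/
private theorem genUpper_mul (l μ a b c : ℤ) :
    ((!![l, a, b; 0, μ, c; 0, 0, l] : Matrix (Fin 3) (Fin 3) ℤ) - l • (1 : Matrix (Fin 3) (Fin 3) ℤ)) *
        (!![l, a, b; 0, μ, c; 0, 0, l] - μ • (1 : Matrix (Fin 3) (Fin 3) ℤ)) =
      !![0, 0, a * c - (μ - l) * b; 0, 0, 0; 0, 0, 0] := by
  have e1 : (!![l, a, b; 0, μ, c; 0, 0, l] : Matrix (Fin 3) (Fin 3) ℤ) - l • (1 : Matrix (Fin 3) (Fin 3) ℤ) =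
      !![0, a, b; 0, μ - l, c; 0, 0, 0] := by
    ext i j
    rw [Matrix.sub_apply, Matrix.smul_apply, smul_eq_mul, Matrix.one_apply]
    fin_cases i <;> fin_cases j <;> simp
  have e2 : (!![l, a, b; 0, μ, c; 0, 0, l] : Matrix (Fin 3) (Fin 3) ℤ) - μ • (1 : Matrix (Fin 3) (Fin 3) ℤ) =
      !![l - μ, a, b; 0, 0, c; 0, 0, l - μ] := by
    ext i j
    rw [Matrix.sub_apply, Matrix.smul_apply, smul_eq_mul, Matrix.one_apply]
    fin_cases i <;> fin_cases j <;> simp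
  rw [e1, e2]
  ext i j
  fin_cases i <;> fin_cases j <;> simp <;> ring

/-- **The general Jordan type `(2, 1)`** («By subtracting a suitable multiple of the unit matrix we can restrict to
the case with eigenvalue `α ∈ ℤ − {0}` for the `1×1` Jordan block and the eigenvalue `0` for the `2×2` Jordan block.
By multiplying the matrix with the sign of `α` we can restrict to the case `α ∈ ℕ`»): an integer `3 × 3` matrix `N`
with `χ_N = (t − λ)²(t − μ)`, `λ ≠ μ ∈ ℤ`, and `(N − λ)(N − μ) ≠ 0` (a `2 × 2` Jordan block with eigenvalue `λ`) is
`GL₃(ℤ)`-conjugate to EXACTLY ONE matrix `(λ sx sy; 0 μ sz; 0 0 λ)` with `s = sign(μ − λ)` and `(x, y, z)` a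
normal form for `α = |μ − λ|`: `αy − xz > 0`, `0 ≤ 2z ≤ α`, `−α ≤ 2x < α`, `x ≤ 0` if `z ∈ {0, α/2}`.
[cite: HertlingLarabi2026b, §11 (introduction) and Lemma 11.1 (c), (f)(ii), chunks p0037–p0038] -/
theorem existsUnique_conj_normalForm_of_charpoly {N : Matrix (Fin 3) (Fin 3) ℤ} {l μ : ℤ} (hne : l ≠ μ)
    (hχ : N.charpoly = (X - C l) ^ 2 * (X - C μ))
    (hN : (N - l • (1 : Matrix (Fin 3) (Fin 3) ℤ)) * (N - μ • (1 : Matrix (Fin 3) (Fin 3) ℤ)) ≠ 0) :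
    ∃! t : ℤ × ℤ × ℤ, (0 < |μ - l| * t.2.1 - t.1 * t.2.2 ∧ 0 ≤ t.2.2 ∧ 2 * t.2.2 ≤ |μ - l| ∧
        -|μ - l| ≤ 2 * t.1 ∧ 2 * t.1 < |μ - l| ∧ ((t.2.2 = 0 ∨ 2 * t.2.2 = |μ - l|) → t.1 ≤ 0)) ∧
      ∃ P : Matrix (Fin 3) (Fin 3) ℤ, IsUnit P.det ∧
        P * N = !![l, Int.sign (μ - l) * t.1, Int.sign (μ - l) * t.2.1; 0, μ, Int.sign (μ - l) * t.2.2; 0, 0, l]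
          * P := by
  set α : ℤ := |μ - l| with hα_def
  set s : ℤ := Int.sign (μ - l) with hs_def
  have hμl : μ - l ≠ 0 := sub_ne_zero.2 (Ne.symm hne)
  have hα : 0 < α := abs_pos.2 hμl
  have hsα : s * α = μ - l := Int.sign_mul_abs _
  have hs : s * s = 1 := by
    rcases lt_or_gt_of_ne hμl with h | h
    · rw [hs_def, Int.sign_eq_neg_one_of_neg h]; norm_num
    · rw [hs_def, Int.sign_eq_one_of_pos h]; norm_num
  have hμ : μ = l + s * α := by linear_combination -hsα
  have e3 : ∀ w : ℤ, s * (s * w) = w := fun w => by rw [← mul_assoc, hs, one_mul]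
  -- `N = λ·1 + s·N'` with `N' := s(N − λ·1)`
  have hNN : N = l • (1 : Matrix (Fin 3) (Fin 3) ℤ) + s • (s • (N - l • (1 : Matrix (Fin 3) (Fin 3) ℤ))) := by
    rw [smul_smul, hs, one_smul, add_sub_cancel]
  -- existence
  have hex : ∃ t : ℤ × ℤ × ℤ, (0 < α * t.2.1 - t.1 * t.2.2 ∧ 0 ≤ t.2.2 ∧ 2 * t.2.2 ≤ α ∧ -α ≤ 2 * t.1 ∧
      2 * t.1 < α ∧ ((t.2.2 = 0 ∨ 2 * t.2.2 = α) → t.1 ≤ 0)) ∧ ∃ P : Matrix (Fin 3) (Fin 3) ℤ, IsUnit P.det ∧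
        P * N = !![l, s * t.1, s * t.2.1; 0, μ, s * t.2.2; 0, 0, l] * P := by
    have hχ' : N.charpoly = (X - C l) * (X - C μ) * (X - C l) := by rw [hχ]; ring
    obtain ⟨a, b, c, P, hP, hPN⟩ := exists_conj_upperTriangular hχ'
    -- regularity of the triangular form: `ac − (μ − λ)b ≠ 0`
    have hreg : a * c - (μ - l) * b ≠ 0 := by
      intro h0
      have h2 : P * ((N - l • (1 : Matrix (Fin 3) (Fin 3) ℤ)) * (N - μ • (1 : Matrix (Fin 3) (Fin 3) ℤ))) = 0 := by
        rw [← Matrix.mul_assoc, conj_sub_smul_one hPN l, Matrix.mul_assoc, conj_sub_smul_one hPN μ,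
          ← Matrix.mul_assoc, genUpper_mul, h0]
        ext i j
        fin_cases i <;> fin_cases j <;> simp [Matrix.mul_apply, Fin.sum_univ_three]
      have hu : IsUnit P := (Matrix.isUnit_iff_isUnit_det P).2 hP
      exact hN (hu.mul_right_inj.1 (h2.trans (Matrix.mul_zero P).symm))
    -- `N' ∼ T_α(sa, sb, sc)`
    have hU : (!![l, a, b; 0, μ, c; 0, 0, l] : Matrix (Fin 3) (Fin 3) ℤ) =
        l • (1 : Matrix (Fin 3) (Fin 3) ℤ) + s • !![0, s * a, s * b; 0, α, s * c; 0, 0, 0] := by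
      rw [← genForm_eq l μ s α _ _ _ hμ, e3, e3, e3]
    rw [hU, hNN, conj_affine_iff l s hs] at hPN
    have hd : α * (s * b) - s * a * (s * c) ≠ 0 := by
      intro h0
      apply hreg
      linear_combination (-1 : ℤ) * h0 + b * hsα - a * c * hs
    obtain ⟨x, y, z, hnf, hc⟩ := exists_conj_normalForm_of_form hα hd
    obtain ⟨Q, hQ, hQN⟩ := conj_trans ⟨P, hP, hPN⟩ hc
    refine ⟨(x, y, z), hnf, Q, hQ, ?_⟩
    rw [genForm_eq l μ s α x y z hμ, hNN, conj_affine_iff l s hs]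
    exact hQN
  obtain ⟨t, ht, hconj⟩ := hex
  refine ⟨t, ⟨ht, hconj⟩, ?_⟩
  rintro t' ⟨ht', hconj'⟩
  -- uniqueness: `G(t') ∼ G(t)` gives `T(t') ∼ T(t)`
  have h := conj_trans (conj_symm hconj') hconj
  rw [genForm_eq l μ s α _ _ _ hμ, genForm_eq l μ s α _ _ _ hμ] at h
  simp only [conj_affine_iff l s hs] at h
  obtain ⟨e₁, e₂, e₃⟩ := normalForm_unique hα ht' ht h
  exact Prod.ext e₁ (Prod.ext e₂ e₃)

/-! ## §8 Lemma 11.1 (f)(i) and the dictionary between the windows (11.6) and the entry windows -/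

/-- **LEMMA 11.1 (f)(i)** («a straightforward calculation»): with `Δ = (0 1 δ₁; 0 0 1; δ₂ δ₃ 0)` the matrix of the
`ℤ`-basis `𝓑 = e·Δ` of (11.6) (`e = (e₁, e₂, a)`) and `U = (α 0 0; 0 0 0; 0 1 0)` the matrix of the multiplication
by `αe₁ + a` in the basis `e` (`(αe₁ + a)e₁ = αe₁`, `(αe₁ + a)e₂ = a`, `(αe₁ + a)a = 0`), the equation
`(αe₁ + a)𝓑 = 𝓑·M_𝓑`, i.e. `U·Δ = Δ·M_𝓑`, holds for the matrix `M_𝓑` of (11.9).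
[cite: HertlingLarabi2026b, §11 Lemma 11.1 (f)(i) with (11.5), (11.9), chunk p0037] -/
theorem delta_mul_normalForm_eq (α δ₁ δ₂ δ₃ : ℚ) (hδ₂ : δ₂ ≠ 0) :
    (!![0, 1, δ₁; 0, 0, 1; δ₂, δ₃, 0] : Matrix (Fin 3) (Fin 3) ℚ) *
        !![0, -α * δ₃ / δ₂, 1 / δ₂ - α * δ₁ * δ₃ / δ₂; 0, α, α * δ₁; 0, 0, 0] =
      !![α, 0, 0; 0, 0, 0; 0, 1, 0] * !![0, 1, δ₁; 0, 0, 1; δ₂, δ₃, 0] := by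
  ext i j
  fin_cases i <;> fin_cases j <;> simp [Matrix.mul_apply, Fin.sum_univ_three] <;> field_simp <;> ring

/-- For the entries `x = −αδ₃/δ₂`, `y = 1/δ₂ − αδ₁δ₃/δ₂`, `z = αδ₁` of (11.9): `αy − xz = α/δ₂`.
[cite: HertlingLarabi2026b, §11 (11.9) and Lemma 11.1 (e) (`α₂ = δ₂`), chunk p0037] -/
theorem sub_mul_eq_div_delta (α δ₁ δ₂ δ₃ : ℚ) :
    α * (1 / δ₂ - α * δ₁ * δ₃ / δ₂) - -α * δ₃ / δ₂ * (α * δ₁) = α / δ₂ := by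
  ring

/-- **The dictionary**: for `α > 0` and `δ₂ ≠ 0`, the windows (11.6) for `(δ₁, δ₂, δ₃)` — `δ₁ ∈ [0, ½]`, `δ₂ > 0`,
`δ₃ ∈ (−½δ₂, ½δ₂]` if `δ₁ ∈ (0, ½)`, `δ₃ ∈ [0, ½δ₂]` if `δ₁ ∈ {0, ½}` — are EQUIVALENT to the entry windows used in
this file for `x = −αδ₃/δ₂`, `y = 1/δ₂ − αδ₁δ₃/δ₂`, `z = αδ₁`: `αy − xz > 0`, `0 ≤ 2z ≤ α`, `−α ≤ 2x < α`, and
`x ≤ 0` if `z ∈ {0, α/2}`. [cite: HertlingLarabi2026b, §11 Lemma 11.1 (c) (11.6) and (f) (11.9), chunk p0037] -/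
theorem normalForm_iff_delta {α δ₂ : ℚ} (hα : 0 < α) (hδ₂ : δ₂ ≠ 0) (δ₁ δ₃ : ℚ) :
    ((0 ≤ δ₁ ∧ δ₁ ≤ 1 / 2) ∧ 0 < δ₂ ∧ ((0 < δ₁ ∧ δ₁ < 1 / 2) → (-(δ₂ / 2) < δ₃ ∧ δ₃ ≤ δ₂ / 2)) ∧
        ((δ₁ = 0 ∨ δ₁ = 1 / 2) → (0 ≤ δ₃ ∧ δ₃ ≤ δ₂ / 2))) ↔
      (0 < α * (1 / δ₂ - α * δ₁ * δ₃ / δ₂) - -α * δ₃ / δ₂ * (α * δ₁) ∧ 0 ≤ α * δ₁ ∧ 2 * (α * δ₁) ≤ α ∧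
        -α ≤ 2 * (-α * δ₃ / δ₂) ∧ 2 * (-α * δ₃ / δ₂) < α ∧
          ((α * δ₁ = 0 ∨ 2 * (α * δ₁) = α) → -α * δ₃ / δ₂ ≤ 0)) := by
  rw [sub_mul_eq_div_delta]
  -- the individual translations, valid for `δ₂ > 0`
  have t1 : 0 ≤ α * δ₁ ↔ 0 ≤ δ₁ := by
    constructor
    · intro h; nlinarith
    · intro h; positivity
  have t2 : 2 * (α * δ₁) ≤ α ↔ δ₁ ≤ 1 / 2 := by
    constructor
    · intro h; nlinarith
    · intro h; nlinarith
  have t3 : (α * δ₁ = 0 ∨ 2 * (α * δ₁) = α) ↔ (δ₁ = 0 ∨ δ₁ = 1 / 2) := by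
    constructor
    · rintro (h | h)
      · exact Or.inl ((mul_eq_zero.1 h).resolve_left hα.ne')
      · right
        have : α * (2 * δ₁ - 1) = 0 := by linear_combination h
        have := (mul_eq_zero.1 this).resolve_left hα.ne'
        linarith
    · rintro (h | h)
      · left; rw [h, mul_zero]
      · right; rw [h]; ring
  constructor
  · rintro ⟨⟨h1, h2⟩, hδ, hnb, hb⟩
    have hx : -α * δ₃ / δ₂ = -α * (δ₃ / δ₂) := by ring
    -- `δ₃ ∈ (−½δ₂, ½δ₂]` in all cases
    have h3 : -(δ₂ / 2) < δ₃ ∧ δ₃ ≤ δ₂ / 2 := by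
      rcases eq_or_lt_of_le h1 with e | l1
      · obtain ⟨a, b⟩ := hb (Or.inl e.symm); exact ⟨by linarith, b⟩
      rcases eq_or_lt_of_le h2 with e | l2
      · obtain ⟨a, b⟩ := hb (Or.inr e); exact ⟨by linarith, b⟩
      exact hnb ⟨l1, l2⟩
    have q1 : δ₃ / δ₂ ≤ 1 / 2 := by rw [div_le_iff₀ hδ]; linarith
    have q2 : -(1 / 2) < δ₃ / δ₂ := by rw [lt_div_iff₀ hδ]; linarith
    refine ⟨div_pos hα hδ, t1.2 h1, t2.2 h2, by rw [hx]; nlinarith, by rw [hx]; nlinarith, fun hz => ?_⟩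
    obtain ⟨a, -⟩ := hb (t3.1 hz)
    rw [hx]
    have : 0 ≤ δ₃ / δ₂ := div_nonneg a hδ.le
    nlinarith
  · rintro ⟨hd, h1, h2, h4, h5, hb⟩
    have hδ : 0 < δ₂ := by
      rcases lt_or_gt_of_ne hδ₂ with h | h
      · exfalso
        have : α / δ₂ < 0 := div_neg_of_pos_of_neg hα h
        linarith
      · exact h
    have hx : -α * δ₃ / δ₂ = -α * (δ₃ / δ₂) := by ring
    rw [hx] at h4 h5 hb
    have q1 : δ₃ / δ₂ ≤ 1 / 2 := by nlinarith
    have q2 : -(1 / 2) < δ₃ / δ₂ := by nlinarith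
    rw [div_le_iff₀ hδ] at q1
    rw [lt_div_iff₀ hδ] at q2
    refine ⟨⟨t1.1 h1, t2.1 h2⟩, hδ, fun _ => ⟨by linarith, by linarith⟩, fun hz => ⟨?_, by linarith⟩⟩
    have h6 := hb (t3.2 hz)
    have : 0 ≤ δ₃ / δ₂ := by nlinarith
    rw [le_div_iff₀ hδ] at this
    linarith

/-! ## §9 The order of a class, read off the normal form (Lemma 11.1 (b), (e)); the content of `N² − αN` (row g41-#2) -/

/-- The normal form as a rational matrix. [cite: HertlingLarabi2026b, §11 (11.9), chunk p0037] -/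
theorem normalForm_map_intCast (α x y z : ℤ) :
    (!![0, x, y; 0, α, z; 0, 0, 0] : Matrix (Fin 3) (Fin 3) ℤ).map (Int.cast : ℤ → ℚ) =
      !![(0 : ℚ), x, y; 0, α, z; 0, 0, 0] := by
  ext i j
  fin_cases i <;> fin_cases j <;> simp

/-- `u·1 + v·T + w·T²` for `T = (0 x y; 0 α z; 0 0 0)` over `ℚ`: with `W := v + wα` it is
`(u xW vy+wxz; 0 u+αW zW; 0 0 u)`. [cite: HertlingLarabi2026b, §11 Lemma 11.1 (e)–(f), chunk p0037] -/
theorem smul_one_add_smul_add_smul_sq (α x y z u v w : ℚ) :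
    u • (1 : Matrix (Fin 3) (Fin 3) ℚ) + v • !![0, x, y; 0, α, z; 0, 0, 0] +
        w • (!![0, x, y; 0, α, z; 0, 0, 0] : Matrix (Fin 3) (Fin 3) ℚ) ^ 2 =
      !![u, x * (v + w * α), v * y + w * (x * z); 0, u + α * (v + w * α), z * (v + w * α); 0, 0, u] := by
  rw [pow_two, Matrix.mul_fin_three, Matrix.one_fin_three]
  ext i j
  fin_cases i <;> fin_cases j <;> simp <;> ring

/-- **The ring `ℚ[T] ∩ M_{3×3}(ℤ)` of the normal form** (HL: the order `𝒪(L)` of the class, whose basis (11.3) has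
the invariants (11.8)): `u·1 + v·T + w·T²` (`u, v, w ∈ ℚ`) is an integer matrix iff `u ∈ ℤ`, `xW, αW, zW ∈ ℤ` and
`vy + wxz ∈ ℤ`, where `W = v + wα`. [cite: HertlingLarabi2026b, §11 Lemma 11.1 (e) (11.8) with (f) (11.9), chunk p0037] -/
theorem isInt_smul_one_add_iff (α x y z : ℤ) (u v w : ℚ) :
    (∃ K : Matrix (Fin 3) (Fin 3) ℤ, K.map (Int.cast : ℤ → ℚ) =
        u • (1 : Matrix (Fin 3) (Fin 3) ℚ) + v • !![(0 : ℚ), x, y; 0, α, z; 0, 0, 0] +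
          w • (!![(0 : ℚ), x, y; 0, α, z; 0, 0, 0] : Matrix (Fin 3) (Fin 3) ℚ) ^ 2) ↔
      (∃ k : ℤ, u = k) ∧ (∃ k : ℤ, (x : ℚ) * (v + w * α) = k) ∧ (∃ k : ℤ, (α : ℚ) * (v + w * α) = k) ∧
        (∃ k : ℤ, (z : ℚ) * (v + w * α) = k) ∧ ∃ k : ℤ, v * y + w * (x * z) = k := by
  rw [smul_one_add_smul_add_smul_sq]
  constructor
  · rintro ⟨K, hK⟩
    have e00 := congr_fun (congr_fun hK 0) 0
    have e01 := congr_fun (congr_fun hK 0) 1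
    have e02 := congr_fun (congr_fun hK 0) 2
    have e11 := congr_fun (congr_fun hK 1) 1
    have e12 := congr_fun (congr_fun hK 1) 2
    simp at e00 e01 e02 e11 e12
    exact ⟨⟨K 0 0, e00.symm⟩, ⟨K 0 1, e01.symm⟩, ⟨K 1 1 - K 0 0, by push_cast; rw [e11, e00]; ring⟩,
      ⟨K 1 2, e12.symm⟩, ⟨K 0 2, e02.symm⟩⟩
  · rintro ⟨⟨k₀, hk₀⟩, ⟨k₁, hk₁⟩, ⟨k₂, hk₂⟩, ⟨k₃, hk₃⟩, ⟨k₄, hk₄⟩⟩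
    refine ⟨!![k₀, k₁, k₄; 0, k₀ + k₂, k₃; 0, 0, k₀], ?_⟩
    ext i j
    fin_cases i <;> fin_cases j <;> simp [hk₀, ← hk₁, ← hk₂, ← hk₃, ← hk₄]

/-- **LEMMA 11.1 (b)+(e), matrix form: the order of the class is the cyclic order `Λ_α = ℤ[αe₁ + a]` — i.e.
`ℚ[T] ∩ M_{3×3}(ℤ) = ℤ[T]` — iff `αy − xz = 1`** (for a normal form, `αy − xz > 0`).  In HL's invariants: (11.8)
gives `α₂ = δ₂ = α/(αy − xz)`, and `Λ = Λ_α ⟺ n₁ = n₂ = n₃ = 1` in (11.4), where `n₂ = α/α₂ = αy − xz`.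
[cite: HertlingLarabi2026b, §11 Lemma 11.1 (b) and (e), chunk p0037] -/
theorem saturated_iff_sub_mul_eq_one {α x y z : ℤ} (hα : 0 < α) (hd : 0 < α * y - x * z) :
    (∀ u v w : ℚ, (∃ K : Matrix (Fin 3) (Fin 3) ℤ, K.map (Int.cast : ℤ → ℚ) =
        u • (1 : Matrix (Fin 3) (Fin 3) ℚ) + v • !![(0 : ℚ), x, y; 0, α, z; 0, 0, 0] +
          w • (!![(0 : ℚ), x, y; 0, α, z; 0, 0, 0] : Matrix (Fin 3) (Fin 3) ℚ) ^ 2) →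
        ∃ a b c : ℤ, u = a ∧ v = b ∧ w = c) ↔ α * y - x * z = 1 := by
  have hα' : (α : ℚ) ≠ 0 := by exact_mod_cast hα.ne'
  constructor
  · intro h
    have hd0 : ((α * y - x * z : ℤ) : ℚ) ≠ 0 := by exact_mod_cast hd.ne'
    have hW : (α : ℚ) / (α * y - x * z : ℤ) + -1 / (α * y - x * z : ℤ) * α = 0 := by
      field_simp; ring
    obtain ⟨a, b, c, -, -, hc⟩ := h 0 ((α : ℚ) / (α * y - x * z : ℤ)) (-1 / (α * y - x * z : ℤ))
      ((isInt_smul_one_add_iff α x y z _ _ _).2 ⟨⟨0, by simp⟩, ⟨0, by rw [hW]; simp⟩, ⟨0, by rw [hW]; simp⟩,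
        ⟨0, by rw [hW]; simp⟩, ⟨1, by field_simp; push_cast; ring⟩⟩)
    have hcd : c * (α * y - x * z) = -1 := by
      have e : (c : ℚ) * (α * y - x * z : ℤ) = -1 := by rw [← hc]; field_simp
      exact_mod_cast e
    rcases Int.eq_one_or_neg_one_of_mul_eq_one' (show -c * (α * y - x * z) = 1 by linear_combination -hcd)
      with ⟨-, h1⟩ | ⟨-, h1⟩
    · exact h1
    · exfalso; linarith
  · intro h1 u v w hK
    obtain ⟨⟨k₀, hk₀⟩, ⟨k₁, hk₁⟩, ⟨k₂, hk₂⟩, ⟨k₃, hk₃⟩, ⟨k₄, hk₄⟩⟩ := (isInt_smul_one_add_iff α x y z u v w).1 hK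
    have h1' : (α : ℚ) * y - x * z = 1 := by exact_mod_cast h1
    -- `W = v + wα = yk₂ − zk₁ ∈ ℤ`, `v = αk₄ − Wxz ∈ ℤ`, `w = Wy − k₄ ∈ ℤ`
    have hW : v + w * α = y * k₂ - z * k₁ := by
      linear_combination (-(v + w * α)) * h1' + (y : ℚ) * hk₂ - (z : ℚ) * hk₁
    have hv : v = α * k₄ - (y * k₂ - z * k₁) * (x * z) := by
      linear_combination (-v) * h1' + (α : ℚ) * hk₄ - ((x : ℚ) * z) * hW
    have hw : w = (y * k₂ - z * k₁) * y - k₄ := by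
      have e : (α : ℚ) * (w - ((y * k₂ - z * k₁) * y - k₄)) = 0 := by
        linear_combination hW - (y * k₂ - z * k₁) * h1' - hv
      simpa [hα', sub_eq_zero] using e
    exact ⟨k₀, α * k₄ - (y * k₂ - z * k₁) * (x * z), (y * k₂ - z * k₁) * y - k₄, hk₀,
      by push_cast; exact hv, by push_cast; exact hw⟩

/-- The same for ANY `N` in the class of the normal form `T(x, y, z)` (the ring `ℚ[N] ∩ M_{3×3}(ℤ)` is a class
invariant, `GL3ZNilpotentNormalForm.isInt_iff_of_conj`): `ℤ[N]` is the full ring `ℚ[N] ∩ M_{3×3}(ℤ)` iff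
`αy − xz = 1`. [cite: HertlingLarabi2026b, §11 Lemma 11.1 (b) and (e), chunk p0037] -/
theorem saturated_iff_of_conj_normalForm {N : Matrix (Fin 3) (Fin 3) ℤ} {α x y z : ℤ} (hα : 0 < α)
    (hd : 0 < α * y - x * z)
    (h : ∃ P : Matrix (Fin 3) (Fin 3) ℤ, IsUnit P.det ∧ P * N = !![0, x, y; 0, α, z; 0, 0, 0] * P) :
    (∀ u v w : ℚ, (∃ K : Matrix (Fin 3) (Fin 3) ℤ, K.map (Int.cast : ℤ → ℚ) =
        u • (1 : Matrix (Fin 3) (Fin 3) ℚ) + v • N.map (Int.cast : ℤ → ℚ) + w • N.map (Int.cast : ℤ → ℚ) ^ 2) →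
        ∃ a b c : ℤ, u = a ∧ v = b ∧ w = c) ↔ α * y - x * z = 1 := by
  obtain ⟨P, hP, hPN⟩ := h
  simp only [GL3ZNilpotentNormalForm.isInt_iff_of_conj hP hPN, normalForm_map_intCast]
  exact saturated_iff_sub_mul_eq_one hα hd

/-- Conjugation transports `N² − αN`. [folklore] -/
private theorem conj_mul_self_sub_smul {N M P : Matrix (Fin 3) (Fin 3) ℤ} (h : P * N = M * P) (α : ℤ) :
    P * (N * N - α • N) = (M * M - α • M) * P := by
  rw [Matrix.mul_sub, Matrix.sub_mul, ← Matrix.mul_assoc, h, Matrix.mul_assoc, h, ← Matrix.mul_assoc,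
    Matrix.mul_smul, h, Matrix.smul_mul]

/-- **The content of `T² − αT` is `αy − xz`** (for a normal form): the gcd of the entries of
`T² − αT = (xz − αy)E₁₃`. [cite: HertlingLarabi2026b, §11 Lemma 11.1 (e) (`α₂ = δ₂`), chunk p0037] -/
theorem gcd_entries_normalForm {α x y z : ℤ} (hd : 0 < α * y - x * z) :
    (Finset.univ.gcd fun ij : Fin 3 × Fin 3 =>
        ((!![0, x, y; 0, α, z; 0, 0, 0] : Matrix (Fin 3) (Fin 3) ℤ) * !![0, x, y; 0, α, z; 0, 0, 0] -
          α • !![0, x, y; 0, α, z; 0, 0, 0]) ij.1 ij.2) = α * y - x * z := by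
  rw [mul_self_sub_smul]
  refine Int.dvd_antisymm (Int.nonneg_of_normalize_eq_self Finset.normalize_gcd) hd.le ?_ ?_
  · refine (Finset.gcd_dvd (f := fun ij : Fin 3 × Fin 3 =>
      (!![0, 0, x * z - α * y; 0, 0, 0; 0, 0, 0] : Matrix (Fin 3) (Fin 3) ℤ) ij.1 ij.2)
      (Finset.mem_univ ((0 : Fin 3), (2 : Fin 3)))).trans ?_
    exact ⟨-1, by simp⟩
  · refine Finset.dvd_gcd fun ij _ => ?_
    obtain ⟨i, j⟩ := ij
    fin_cases i <;> fin_cases j <;> simp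
    exact ⟨-1, by ring⟩

/-- **The content of `N² − αN` is the class invariant `αy − xz`** of the normal form of `N` (`= α/α₂ = n₂` in HL's
invariants). [cite: HertlingLarabi2026b, §11 Lemma 11.1 (e), chunk p0037] -/
theorem gcd_entries_eq_of_conj_normalForm {N : Matrix (Fin 3) (Fin 3) ℤ} {α x y z : ℤ} (hd : 0 < α * y - x * z)
    (h : ∃ P : Matrix (Fin 3) (Fin 3) ℤ, IsUnit P.det ∧ P * N = !![0, x, y; 0, α, z; 0, 0, 0] * P) :
    (Finset.univ.gcd fun ij : Fin 3 × Fin 3 => (N * N - α • N) ij.1 ij.2) = α * y - x * z := by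
  obtain ⟨P, hP, hPN⟩ := h
  rw [NonSemisimpleIntegerMatrixClasses.gcd_entries_eq_of_conj hP (conj_mul_self_sub_smul hPN α),
    gcd_entries_normalForm hd]

/-- Hence for `N` with `χ_N = t²(t − α)`, `α ≥ 1`, `N² ≠ αN`: **`ℤ[N] = ℚ[N] ∩ M_{3×3}(ℤ)` (the order of the class
is the cyclic order `Λ_α`) iff `N² − αN` is PRIMITIVE** (content `1`).
[cite: HertlingLarabi2026b, §11 Lemma 11.1 (b), (e), chunk p0037] -/
theorem saturated_iff_gcd_entries_eq_one {N : Matrix (Fin 3) (Fin 3) ℤ} {α : ℤ} (hα : 0 < α)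
    (hχ : N.charpoly = X ^ 2 * (X - C α)) (hN : N * N ≠ α • N) :
    (∀ u v w : ℚ, (∃ K : Matrix (Fin 3) (Fin 3) ℤ, K.map (Int.cast : ℤ → ℚ) =
        u • (1 : Matrix (Fin 3) (Fin 3) ℚ) + v • N.map (Int.cast : ℤ → ℚ) + w • N.map (Int.cast : ℤ → ℚ) ^ 2) →
        ∃ a b c : ℤ, u = a ∧ v = b ∧ w = c) ↔
      (Finset.univ.gcd fun ij : Fin 3 × Fin 3 => (N * N - α • N) ij.1 ij.2) = 1 := by
  obtain ⟨x, y, z, hnf, hconj⟩ := exists_conj_normalForm hα hχ hN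
  rw [saturated_iff_of_conj_normalForm hα hnf.1 hconj, gcd_entries_eq_of_conj_normalForm hnf.1 hconj]

/-! ## §10 The class number of the cyclic order `Λ_α = ℤ[t]/(t²(t − α))`: `φ(α)/2` for `α ≥ 3`, `1` for `α ∈ {1, 2}` -/

/-- The normal forms with `αy − xz = 1` for `α ≥ 3` have `0 < 2z < α` and `gcd(α, z) = 1`. [cite: HertlingLarabi2026b, §11 Thm. 11.2 (a)–(b), chunks p0038–p0039] -/
private theorem z_window_of_sub_mul_eq_one {α x y z : ℤ} (hα : 3 ≤ α) (hz0 : 0 ≤ z) (hz2 : 2 * z ≤ α)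
    (h1 : α * y - x * z = 1) : 0 < z ∧ 2 * z < α ∧ IsCoprime α z := by
  have hcop : IsCoprime α z := ⟨y, -x, by linear_combination h1⟩
  refine ⟨?_, ?_, hcop⟩
  · rcases eq_or_lt_of_le hz0 with e | l
    · exfalso
      rw [← e, mul_zero, sub_zero] at h1
      have := Int.eq_one_of_mul_eq_one_right (by omega) h1
      omega
    · exact l
  · rcases eq_or_lt_of_le hz2 with e | l
    · exfalso
      -- `α = 2z`: `z ∣ α` and `z ∣ xz` give `z ∣ 1`
      have hz1 : z ∣ 1 := ⟨2 * y - x, by linear_combination -h1 - y * e⟩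
      have := Int.eq_one_of_dvd_one hz0 hz1
      omega
    · exact l

/-- Two normal forms with `αy − xz = 1 = αy′ − x′z` and the same `z` coincide. [cite: HertlingLarabi2026b, §11 Lemma 11.1 (c), chunk p0038] -/
private theorem eq_of_sub_mul_eq_one {α x y x' y' z : ℤ} (hα : 0 < α) (hx1 : -α ≤ 2 * x) (hx2 : 2 * x < α)
    (hx1' : -α ≤ 2 * x') (hx2' : 2 * x' < α) (h1 : α * y - x * z = 1) (h1' : α * y' - x' * z = 1) :
    x = x' ∧ y = y' := by
  have hcop : IsCoprime α z := ⟨y, -x, by linear_combination h1⟩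
  have hdvd : α ∣ (x - x') * z := ⟨y - y', by linear_combination h1' - h1⟩
  obtain ⟨k, hk⟩ := hcop.dvd_of_dvd_mul_right hdvd
  have hx : x = x' := eq_of_sub_eq_mul hα hk (by omega) (by omega)
  refine ⟨hx, ?_⟩
  subst hx
  have : α * y = α * y' := by linear_combination h1 - h1'
  exact mul_left_cancel₀ hα.ne' this

/-- For `a ≥ 3`: `2·#{z ∈ [0, a) | gcd(a, z) = 1, 2z < a} = φ(a)` (the units `±z mod a` pair off; `0` and `a/2`
are not units). [folklore] -/
private theorem two_mul_card_coprime_half {a : ℕ} (ha : 3 ≤ a) :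
    2 * ((Finset.range a).filter (fun z => a.Coprime z ∧ 2 * z < a)).card = Nat.totient a := by
  rw [Nat.totient_eq_card_coprime]
  have hU : (Finset.range a).filter a.Coprime =
      (Finset.range a).filter (fun z => a.Coprime z ∧ 2 * z < a) ∪
        (Finset.range a).filter (fun z => a.Coprime z ∧ a < 2 * z) := by
    ext z
    simp only [Finset.mem_filter, Finset.mem_union, Finset.mem_range]
    constructor
    · rintro ⟨hz, hc⟩
      rcases lt_trichotomy (2 * z) a with h | h | h
      · exact Or.inl ⟨hz, hc, h⟩
      · exfalso
        rw [← h] at hc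
        have hz1 : z = 1 := Nat.Coprime.eq_one_of_dvd hc.symm (Dvd.intro_left 2 rfl)
        omega
      · exact Or.inr ⟨hz, hc, h⟩
    · rintro (⟨hz, hc, -⟩ | ⟨hz, hc, -⟩) <;> exact ⟨hz, hc⟩
  have hdisj : Disjoint ((Finset.range a).filter (fun z => a.Coprime z ∧ 2 * z < a))
      ((Finset.range a).filter (fun z => a.Coprime z ∧ a < 2 * z)) :=
    Finset.disjoint_filter.2 fun z _ h1 h2 => by omega
  have hcard : ((Finset.range a).filter (fun z => a.Coprime z ∧ a < 2 * z)).card =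
      ((Finset.range a).filter (fun z => a.Coprime z ∧ 2 * z < a)).card := by
    refine Finset.card_nbij' (fun z => a - z) (fun z => a - z) ?_ ?_ ?_ ?_
    · intro z hz
      simp only [Finset.coe_filter, Finset.mem_range, Set.mem_setOf_eq] at hz ⊢
      obtain ⟨hza, hc, h2⟩ := hz
      exact ⟨by omega, (Nat.coprime_self_sub_right hza.le).2 hc, by omega⟩
    · intro z hz
      simp only [Finset.coe_filter, Finset.mem_range, Set.mem_setOf_eq] at hz ⊢
      obtain ⟨hza, hc, h2⟩ := hz
      have hz0 : z ≠ 0 := by rintro rfl; simp [Nat.coprime_zero_right] at hc; omega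
      exact ⟨by omega, (Nat.coprime_self_sub_right hza.le).2 hc, by omega⟩
    · intro z hz
      simp only [Finset.coe_filter, Finset.mem_range, Set.mem_setOf_eq] at hz
      show a - (a - z) = z
      omega
    · intro z hz
      simp only [Finset.coe_filter, Finset.mem_range, Set.mem_setOf_eq] at hz
      show a - (a - z) = z
      omega
  rw [hU, Finset.card_union_of_disjoint hdisj, hcard]
  ring

/-- **The normal forms with `αy − xz = 1`, counted** (`α ≥ 3`): they are in bijection with the residues
`z ∈ (0, α/2)` prime to `α` (for each such `z` exactly one `x` in the window with `xz ≡ −1 mod α`, and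
`y = (1 + xz)/α`), so their number is `φ(α)/2` — HL: `|G([Λ_α]_ε)| = |G([pr_F Λ_α]_ε)| = φ(α₁)/2` with `α₁ = α`
(Theorem 11.2 (b), Claim (I) in its proof, via Theorem 5.10 and Theorem 9.1 (d)).
[cite: HertlingLarabi2026b, §11 Thm. 11.2 (b) with proof, Claim (I) (chunks p0038–p0039); §9.2 Thm. 9.1 (d) (chunk p0028)] -/
theorem natCard_normalForm_sub_mul_eq_one {α : ℤ} (hα : 3 ≤ α) :
    Nat.card {t : ℤ × ℤ × ℤ // (0 < α * t.2.1 - t.1 * t.2.2 ∧ 0 ≤ t.2.2 ∧ 2 * t.2.2 ≤ α ∧ -α ≤ 2 * t.1 ∧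
        2 * t.1 < α ∧ ((t.2.2 = 0 ∨ 2 * t.2.2 = α) → t.1 ≤ 0)) ∧ α * t.2.1 - t.1 * t.2.2 = 1} =
      Nat.totient α.toNat / 2 := by
  obtain ⟨a, rfl⟩ : ∃ a : ℕ, α = a := ⟨α.toNat, (Int.toNat_of_nonneg (by omega)).symm⟩
  have ha : 3 ≤ a := by exact_mod_cast hα
  have ha0 : (0 : ℤ) < a := by exact_mod_cast (show 0 < a by omega)
  rw [Int.toNat_natCast, ← two_mul_card_coprime_half ha, Nat.mul_div_cancel_left _ (by norm_num : 0 < 2)]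
  set U := (Finset.range a).filter (fun z => a.Coprime z ∧ 2 * z < a) with hU_def
  rw [← Fintype.card_coe U, ← Nat.card_eq_fintype_card]
  -- the map `t ↦ z`
  have hmem : ∀ t : {t : ℤ × ℤ × ℤ // (0 < (a : ℤ) * t.2.1 - t.1 * t.2.2 ∧ 0 ≤ t.2.2 ∧ 2 * t.2.2 ≤ (a : ℤ) ∧
      -(a : ℤ) ≤ 2 * t.1 ∧ 2 * t.1 < (a : ℤ) ∧ ((t.2.2 = 0 ∨ 2 * t.2.2 = (a : ℤ)) → t.1 ≤ 0)) ∧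
      (a : ℤ) * t.2.1 - t.1 * t.2.2 = 1}, t.1.2.2.toNat ∈ U := by
    rintro ⟨⟨x, y, z⟩, ⟨-, hz0, hz2, -, -, -⟩, h1⟩
    dsimp only at hz0 hz2 h1 ⊢
    obtain ⟨hz, hz', hcop⟩ := z_window_of_sub_mul_eq_one hα hz0 hz2 h1
    simp only [hU_def, Finset.mem_filter, Finset.mem_range]
    have ez : ((z.toNat : ℕ) : ℤ) = z := Int.toNat_of_nonneg hz0
    refine ⟨?_, ?_, ?_⟩
    · exact_mod_cast (show ((z.toNat : ℕ) : ℤ) < (a : ℤ) by rw [ez]; omega)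
    · rw [← Nat.isCoprime_iff_coprime, ez]
      exact hcop
    · exact_mod_cast (show 2 * ((z.toNat : ℕ) : ℤ) < (a : ℤ) by rw [ez]; omega)
  refine Nat.card_eq_of_bijective (fun t => ⟨t.1.2.2.toNat, hmem t⟩) ⟨?_, ?_⟩
  · intro t t' h
    obtain ⟨⟨x, y, z⟩, ⟨_, hz0, _, hx1, hx2, _⟩, h1⟩ := t
    obtain ⟨⟨x', y', z'⟩, ⟨_, hz0', _, hx1', hx2', _⟩, h1'⟩ := t'
    have h' : z.toNat = z'.toNat := congr_arg Subtype.val h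
    dsimp only at hz0 hx1 hx2 h1 hz0' hx1' hx2' h1'
    have hz : z = z' := by
      have := congr_arg (fun n : ℕ => (n : ℤ)) h'
      simpa [Int.toNat_of_nonneg hz0, Int.toNat_of_nonneg hz0'] using this
    subst hz
    obtain ⟨hx, hy⟩ := eq_of_sub_mul_eq_one ha0 hx1 hx2 hx1' hx2' h1 h1'
    subst hx hy
    rfl
  · rintro ⟨z, hz⟩
    simp only [hU_def, Finset.mem_filter, Finset.mem_range] at hz
    obtain ⟨hza, hc, h2⟩ := hz
    have hz0 : z ≠ 0 := by rintro rfl; simp [Nat.coprime_zero_right] at hc; omega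
    obtain ⟨u, v, huv⟩ := Nat.isCoprime_iff_coprime.2 hc
    -- `x₀ = −v` solves `x₀z ≡ −1`; move it into the window
    set x : ℤ := -v + -((-v + (a : ℤ) / 2) / a) * a with hx_def
    have ex : x = (-v + (a : ℤ) / 2) % a - (a : ℤ) / 2 := by rw [hx_def, Int.emod_def]; ring
    have h0 : 0 ≤ (-v + (a : ℤ) / 2) % a := Int.emod_nonneg _ ha0.ne'
    have h1 : (-v + (a : ℤ) / 2) % a < a := Int.emod_lt_of_pos _ ha0
    have hx1 : -(a : ℤ) ≤ 2 * x ∧ 2 * x < a := by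
      rw [ex]
      generalize (-v + (a : ℤ) / 2) % a = r at h0 h1 ⊢
      generalize (a : ℤ) = b at h0 h1 ⊢
      omega
    set y : ℤ := u + -((-v + (a : ℤ) / 2) / a) * z with hy_def
    have hd : (a : ℤ) * y - x * z = 1 := by rw [hy_def, hx_def]; linear_combination huv
    refine ⟨⟨(x, y, (z : ℤ)), ⟨show 0 < (a : ℤ) * y - x * z by omega, show (0 : ℤ) ≤ z by omega,
      show 2 * (z : ℤ) ≤ a by omega, hx1.1, hx1.2, fun h => absurd (show (z : ℤ) = 0 ∨ 2 * (z : ℤ) = a from h)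
        (by omega)⟩, hd⟩, ?_⟩
    exact Subtype.ext (by simp)

/-- The class set with primitive `N² − αN`: its normal forms are exactly those with `αy − xz = 1`. [cite: HertlingLarabi2026b, §11 Lemma 11.1 (b), (e), (f), chunk p0037] -/
private theorem normalForm_mem_one {α x y z : ℤ} (h1 : α * y - x * z = 1) :
    (!![0, x, y; 0, α, z; 0, 0, 0] : Matrix (Fin 3) (Fin 3) ℤ).charpoly = X ^ 2 * (X - C α) ∧
      (Finset.univ.gcd fun ij : Fin 3 × Fin 3 =>
        ((!![0, x, y; 0, α, z; 0, 0, 0] : Matrix (Fin 3) (Fin 3) ℤ) * !![0, x, y; 0, α, z; 0, 0, 0] -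
          α • !![0, x, y; 0, α, z; 0, 0, 0]) ij.1 ij.2) = 1 :=
  ⟨charpoly_form α x y z, by rw [gcd_entries_normalForm (by omega), h1]⟩

/-- **The classes with the cyclic order `Λ_α` ↔ the normal forms with `αy − xz = 1`**: a bijection from the
`GL₃(ℤ)`-classes of integer `N` with `χ_N = t²(t − α)` and `N² − αN` primitive (equivalently
`ℤ[N] = ℚ[N] ∩ M_{3×3}(ℤ)`, §9) onto `{(x, y, z) normal form | αy − xz = 1}` (`α ≥ 1`).
[cite: HertlingLarabi2026b, §11 Lemma 11.1 (b), (c), (f) and Thm. 11.2 (b), chunks p0037–p0039] -/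
theorem exists_bijective_quot_conj_primitive {α : ℤ} (hα : 0 < α) :
    ∃ F : (Quot fun N N' : {N : Matrix (Fin 3) (Fin 3) ℤ // N.charpoly = X ^ 2 * (X - C α) ∧
        (Finset.univ.gcd fun ij : Fin 3 × Fin 3 => (N * N - α • N) ij.1 ij.2) = 1} =>
        ∃ P : Matrix (Fin 3) (Fin 3) ℤ, IsUnit P.det ∧ P * N.1 = N'.1 * P) →
      {t : ℤ × ℤ × ℤ // (0 < α * t.2.1 - t.1 * t.2.2 ∧ 0 ≤ t.2.2 ∧ 2 * t.2.2 ≤ α ∧ -α ≤ 2 * t.1 ∧ 2 * t.1 < α ∧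
        ((t.2.2 = 0 ∨ 2 * t.2.2 = α) → t.1 ≤ 0)) ∧ α * t.2.1 - t.1 * t.2.2 = 1},
      Function.Bijective F := by
  set S := {N : Matrix (Fin 3) (Fin 3) ℤ // N.charpoly = X ^ 2 * (X - C α) ∧
    (Finset.univ.gcd fun ij : Fin 3 × Fin 3 => (N * N - α • N) ij.1 ij.2) = 1}
  set I := {t : ℤ × ℤ × ℤ // (0 < α * t.2.1 - t.1 * t.2.2 ∧ 0 ≤ t.2.2 ∧ 2 * t.2.2 ≤ α ∧ -α ≤ 2 * t.1 ∧
    2 * t.1 < α ∧ ((t.2.2 = 0 ∨ 2 * t.2.2 = α) → t.1 ≤ 0)) ∧ α * t.2.1 - t.1 * t.2.2 = 1}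
  set r : S → S → Prop := fun N N' => ∃ P : Matrix (Fin 3) (Fin 3) ℤ, IsUnit P.det ∧ P * N.1 = N'.1 * P
    with hr_def
  have hr : Equivalence r := equivalence_conj _
  set Nm : I → S := fun t => ⟨!![0, t.1.1, t.1.2.1; 0, α, t.1.2.2; 0, 0, 0], normalForm_mem_one t.2.2⟩
    with hNm_def
  have hex : ∀ N : S, ∃ t : I, r N (Nm t) := fun N => by
    have hN : N.1 * N.1 ≠ α • N.1 := fun h => by
      have h0 := N.2.2
      rw [h, sub_self] at h0
      have h00 : (Finset.univ.gcd fun ij : Fin 3 × Fin 3 => (0 : Matrix (Fin 3) (Fin 3) ℤ) ij.1 ij.2) = 0 :=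
        Finset.gcd_eq_zero_iff.2 fun _ _ => rfl
      rw [h00] at h0
      exact zero_ne_one h0
    obtain ⟨x, y, z, hnf, hconj⟩ := exists_conj_normalForm hα N.2.1 hN
    have h1 : α * y - x * z = 1 := by rw [← gcd_entries_eq_of_conj_normalForm hnf.1 hconj]; exact N.2.2
    exact ⟨⟨(x, y, z), hnf, h1⟩, hconj⟩
  choose f hf using hex
  have hU : ∀ t t' : I, r (Nm t) (Nm t') → t = t' := by
    rintro ⟨⟨x, y, z⟩, hnf, h1⟩ ⟨⟨x', y', z'⟩, hnf', h1'⟩ h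
    obtain ⟨e₁, e₂, e₃⟩ := normalForm_unique hα hnf hnf' h
    subst e₁ e₂ e₃
    rfl
  have hwd : ∀ N N' : S, r N N' → f N = f N' := fun N N' h =>
    hU _ _ (hr.trans (hr.trans (hr.symm (hf N)) h) (hf N'))
  refine ⟨Quot.lift f hwd, ?_, fun t => ⟨Quot.mk r (Nm t), hU _ _ (hr.trans (hr.symm (hf (Nm t))) (hr.refl _))⟩⟩
  rintro ⟨N⟩ ⟨N'⟩ h
  change f N = f N' at h
  exact Quot.sound (hr.trans (hf N) (h ▸ hr.symm (hf N')))

/-- **THE CLASS NUMBER OF THE CYCLIC ORDER `Λ_α = ℤ[t]/(t²(t − α))`, `α ≥ 3`**: the number of `GL₃(ℤ)`-conjugacy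
classes of integer `3 × 3` matrices `N` with `χ_N = t²(t − α)` and `N² − αN` primitive (⟺ `ℤ[N]` is the full ring
`ℚ[N] ∩ M_{3×3}(ℤ)` ⟺ the `Λ_α`-ideal class of `N` has order exactly `Λ_α`) is `φ(α)/2` — HL: such classes form the
group `G([Λ_α]_ε)` (one `w`-class, `τ = 2⁰`, since `μ = gcd(α₁, α₃α₁/α₂) = gcd(α, 1) = 1` for `Λ_α`, Thm. 11.2 (b)(i)),
and `|G([Λ]_ε)| = φ(α₁)/2` (Claim (I): Thm. 5.10 with Thm. 9.1 (d)), `α₁ = α`.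
[cite: HertlingLarabi2026b, §11 Thm. 11.2 (b) with proof, Claim (I) (chunks p0038–p0039); §9.2 Thm. 9.1 (d) (chunk p0028)] -/
theorem natCard_quot_conj_primitive {α : ℤ} (hα : 3 ≤ α) :
    Nat.card (Quot fun N N' : {N : Matrix (Fin 3) (Fin 3) ℤ // N.charpoly = X ^ 2 * (X - C α) ∧
        (Finset.univ.gcd fun ij : Fin 3 × Fin 3 => (N * N - α • N) ij.1 ij.2) = 1} =>
        ∃ P : Matrix (Fin 3) (Fin 3) ℤ, IsUnit P.det ∧ P * N.1 = N'.1 * P) = Nat.totient α.toNat / 2 := by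
  obtain ⟨F, hF⟩ := exists_bijective_quot_conj_primitive (show 0 < α by omega)
  rw [Nat.card_eq_of_bijective F hF, natCard_normalForm_sub_mul_eq_one hα]

/-- … and for `α ∈ {1, 2}` there is exactly ONE such class (`T(0, 1, 0)` for `α = 1`, `T(−1, 0, 1)` for `α = 2`) —
HL: «The case `α₁ = 1`: […] there is only one `w`-class, the group `G([Λ]_ε)`», «The case `α = 2`: […] Only
`φ(α₁)/2` must be replaced by `1`», Thm. 9.1 (d): `|G([Λ]_ε)| = 1` if `α ∈ {1, 2}`.
[cite: HertlingLarabi2026b, §11 Thm. 11.2 (b) proof of (iii) (chunk p0039); §9.2 Thm. 9.1 (d) (chunk p0028)] -/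
theorem natCard_quot_conj_primitive_of_le_two {α : ℤ} (hα : 0 < α) (hα2 : α ≤ 2) :
    Nat.card (Quot fun N N' : {N : Matrix (Fin 3) (Fin 3) ℤ // N.charpoly = X ^ 2 * (X - C α) ∧
        (Finset.univ.gcd fun ij : Fin 3 × Fin 3 => (N * N - α • N) ij.1 ij.2) = 1} =>
        ∃ P : Matrix (Fin 3) (Fin 3) ℤ, IsUnit P.det ∧ P * N.1 = N'.1 * P) = 1 := by
  obtain ⟨F, hF⟩ := exists_bijective_quot_conj_primitive hα
  rw [Nat.card_eq_of_bijective F hF, Nat.card_eq_one_iff_exists]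
  rcases (show α = 1 ∨ α = 2 by omega) with rfl | rfl
  · refine ⟨⟨(0, 1, 0), ⟨by norm_num, le_rfl, by norm_num, by norm_num, by norm_num, fun _ => le_rfl⟩, by norm_num⟩, ?_⟩
    rintro ⟨⟨x, y, z⟩, ⟨-, hz0, hz2, hx1, hx2, -⟩, h1⟩
    dsimp only at hz0 hz2 hx1 hx2 h1
    have hz : z = 0 := by omega
    have hx : x = 0 := by omega
    subst hz hx
    have hy : y = 1 := by linarith
    subst hy
    rfl
  · refine ⟨⟨(-1, 0, 1), ⟨by norm_num, by norm_num, by norm_num, by norm_num, by norm_num, fun _ => by norm_num⟩,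
      by norm_num⟩, ?_⟩
    rintro ⟨⟨x, y, z⟩, ⟨-, hz0, hz2, hx1, hx2, hb⟩, h1⟩
    dsimp only at hz0 hz2 hx1 hx2 hb h1
    have hx0 : x ≤ 0 := hb (by omega)
    -- `z ∈ {0, 1}`, `x ∈ {−1, 0}`, `2y − xz = 1` forces `(x, y, z) = (−1, 0, 1)`
    rcases (show z = 0 ∨ z = 1 by omega) with rfl | rfl
    · omega
    · rcases (show x = -1 ∨ x = 0 by omega) with rfl | rfl
      · have hy : y = 0 := by omega
        subst hy
        rfl
      · omega

end Literature.LinearAlgebra.Matrix.GL3ZJordanBlocksTwoOne
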